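/-
Literature file (hubbard-downfold / hubbard-eph front-ends): the McMillan–Allen–Dynes `T_c` formula and the
elementary monotonicity facts that turn a parameter box into a `T_c` band.
-/
import Mathlib.Analysis.SpecialFunctions.Pow.Real
import Mathlib.Analysis.SpecialFunctions.Pow.Deriv
import Mathlib.Analysis.SpecialFunctions.ExpDeriv
import Mathlib.Analysis.SpecialFunctions.Log.Deriv
import HarnessLib

/-!
# The McMillan–Allen–Dynes formula for the transition temperature of an electron–phonon superconductor

This file vendors, as real-valued DEFINITIONS, the semi-empirical strong-coupling formulas for the critical
temperature `T_c` of a conventional (electron–phonon, Migdal–Eliashberg) superconductor, and PROVES the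
elementary monotonicity facts through which screening pipelines use them (a box of input parameters is
mapped to a band of `T_c` values by evaluating the formula at two extreme corners).

* McMillan's formula in the Dynes / Allen–Dynes normalisation (McMillan 1968, Eq. (18), with the prefactor
  `Θ_D/1.45` replaced by `ω_log/1.2`; Allen–Dynes 1975, Eq. (34) with `f₁ = f₂ = 1`; reprinted as
  Flores-Livas et al. 2020, Eq. (65)):
  `T_c = (ω_log / 1.2) · exp( −1.04 (1 + λ) / (λ − μ* (1 + 0.62 λ)) )`  — `mcMillanTc`.
* The Allen–Dynes strong-coupling and shape corrections (Allen–Dynes 1975, Eqs. (34)–(38); Flores-Livas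
  et al. 2020, Eqs. (67)–(69)): `T_c^{AD} = f₁ f₂ · (ω_log / 1.2) · exp(…)` with
  `f₁ = (1 + (λ/Λ₁)^{3/2})^{1/3}`, `f₂ = 1 + (r − 1) λ² / (λ² + Λ₂²)`, `Λ₁ = 2.46 (1 + 3.8 μ*)`,
  `Λ₂ = 1.82 (1 + 6.3 μ*) r`, where `r = ω̄₂ / ω_log` — `allenDynesTc`.

Proved here (first-year calculus on the printed formulas; each theorem's tag names the printed equation it is
about, private helpers are `[folklore]`), on the physical domain
`0 ≤ λ`, `0 ≤ μ*`, `0.62 μ* ≤ 1`, `λ − μ*(1 + 0.62 λ) > 0`, `0 ≤ ω_log`, `1 ≤ r`: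

* `T_c` is monotone increasing in `ω_log` and in `λ` and monotone decreasing in `μ*`, both for the McMillan
  form and for the Allen–Dynes form at fixed `r` (`mcMillanTc_mono_lam`, `mcMillanTc_anti_mu`,
  `allenDynesTc_mono_lam`, `allenDynesTc_anti_mu`, …);
* BOX → BAND: for every point of a box `[ω₋, ω₊] × [λ₋, λ₊] × [μ₋, μ₊]` the value of `T_c` lies between its
  values at the corners `(ω₋, λ₋, μ₊)` and `(ω₊, λ₊, μ₋)` (`mcMillanTc_mem_Icc_of_mem_box`,
  `allenDynesTc_mem_Icc_of_mem_box`). This is the exact statement behind "λ interval × μ* interval ⇒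
  `T_c` band" as used by first-principles screening (e.g. Flores-Livas et al. 2020, Table 1, `μ* = 0.1`).

Design choices. All inputs are plain real parameters (`ω_log` and `T_c` in the same unit, e.g. kelvin;
`λ`, `μ*`, `r` dimensionless); `λ`, `ω_log`, `ω̄₂` and `μ*` are NOT defined here as functionals of an
Eliashberg function `α²F` — they enter as numbers. The formulas are definitions, not claims about any
Hamiltonian: their accuracy relative to the Eliashberg equations is an empirical matter (Allen–Dynes 1975;
Flores-Livas et al. 2020, Fig. 15) and is not asserted. Outside the physical domain the definitions take
Lean's junk values (`x / 0 = 0`, `Real.rpow` of a negative base) and no theorem below speaks about them.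

## References

* W. L. McMillan, *Transition temperature of strong-coupled superconductors*, Phys. Rev. 167 (1968) 331–344,
  Eq. (18). [Mcmillan1968]
* P. B. Allen, R. C. Dynes, *Transition temperature of strong-coupled superconductors reanalyzed*,
  Phys. Rev. B 12 (1975) 905–922, Eqs. (34)–(38). [AllenDynes1975]
* J. A. Flores-Livas, L. Boeri, A. Sanna, G. Profeta, R. Arita, M. Eremets, *A perspective on conventional
  high-temperature superconductors at high pressure: Methods and materials*, Phys. Rep. 856 (2020) 1–78,
  §3.2.4, Eqs. (65)–(69) and Table 1. [FloreslivasEtAl2020]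
* V. Z. Kresin, H. Morawitz, S. A. Wolf, *Superconducting State: Mechanisms and Properties*, Oxford UP
  (2013), §2.2 Eqs. (2.21), (2.27) and §3.5 «The Isotope Effect», Eqs. (3.81)–(3.84) (`T_c = const · M^{−α}`,
  `α ≈ 0.5` because `Ω̃ ∝ M^{−1/2}`; `α = −(M/T_c) ∂T_c/∂M`; `α = α|_{μ*=0}[1 − (μ*/(λ−μ*))²]`). [KresinMorawitzWolf2013]
* P. Morel, P. W. Anderson, *Calculation of the superconducting state parameters with retarded
  electron–phonon interaction*, Phys. Rev. 125 (1962) 1263–1271 (origin of the pseudopotential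
  `μ* = μ/(1 + μ ln(ε_F/ω_c))`; the form used here is the one reprinted as Kresin et al. Eq. (2.27) and
  Flores-Livas et al. Eq. (59)). [MorelAnderson1962]
* T. Klimczuk et al., *Superconductivity in the Heusler family of intermetallics*, Phys. Rev. B 85 (2012)
  174505, arXiv:1205.0433, p. 10 (inverted McMillan formula, μ* = 0.13 / 0.15) and Table II (λ_ep 0.70 / 0.58 /
  0.52; Θ_D 210 / 246 / 277 K; T_c 4.7 / 2.8 / 2.0 K). [KlimczukEtAl2012Heusler]

## Isotope scaling (appended 2026-08-26, hubbard-downfold lit-4)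

* `mcMillanTc_mul_omega`, `allenDynesTc_mul_omega` — both formulas are degree-1 homogeneous in the phonon
  scale at fixed `(λ, μ*, r)`;
* `allenDynesTc_isotope_invariant` / `mcMillanTc_isotope_invariant` — with the HARMONIC scaling
  `ω = κ · M^{−1/2}` of all phonon frequencies (mono-atomic or uniformly substituted lattice; `λ`, `μ*`, `r`
  mass-independent) `T_c(M) · √M` does not depend on `M` (`T_c ∝ M^{−1/2}`), and
  `allenDynesTc_isotope_ratio`: `T_c(M₂)/T_c(M₁) = √(M₁/M₂)` (H → D: `1/√2`);
* `allenDynesTc_isotope_hasDerivAt`, `allenDynesTc_isotope_exponent` — the isotope coefficient as the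
  logarithmic derivative `α = −(M/T_c) ∂T_c/∂M` exists and equals `1/2` EXACTLY under that scaling — the
  baseline against which measured hydride values (H₃S `α ≈ 0.3`; anharmonic theory `0.35`, Flores-Livas et
  al. 2020 §H₃S) and `μ*`-, anharmonic- and multi-ion corrections (Kresin et al. 2013 Eqs. (3.84)–(3.89)) are
  read. Nothing here asserts that a material's phonons scale harmonically;
* `coulombPseudopotential`, `weakCouplingTc` — Kresin–Morawitz–Wolf's weak-coupling
  `T_c = a Ω̃ exp(−1/(λ − μ*(Ω̃)))` with `μ*(Ω̃) = V_c/(1 + V_c ln(ε₀/Ω̃))` (their Eqs. (2.21), (2.27));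
  `coulombPseudopotential_hasDerivAt` (`dμ*/dΩ̃ = μ*²/Ω̃`), `weakCouplingTc_hasDerivAt`
  (`dT_c/dΩ̃ = (T_c/Ω̃)(1 − (μ*/(λ−μ*))²)` — their Eq. (3.84) as an exact derivative),
  `weakCouplingTc_isotope_hasDerivAt` (chain rule with `Ω̃ = κ M^{−1/2}`, Eq. (3.83)) and
  `isotopeExponent_with_muStar` (`α = ½ [1 − (μ*/(λ − μ*))²]`, Eq. (3.84) with `α|_{μ*=0} = ½`).

## The Morel–Anderson pseudopotential (appended 2026-08-27, hubbard-downfold lit-4)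

First-year algebra on the printed definition `μ*(Ω̃) = V_c / (1 + V_c ln(ε₀/Ω̃))` (Kresin–Morawitz–Wolf
Eq. (2.27); the same map is Flores-Livas et al. 2020 Eq. (59), `μ*_c = μ_c/(1 + μ_c log(ε_F/ω_c))`, whose
text adds «in the original Éliashberg equations the value of `μ*_c` is linked to the cutoff frequency `ω_c`
and it should be computed from equation 59: its value may differ significantly from 0.11»; origin
Morel–Anderson 1962). With `L = ln(ε₀/Ω̃) > 0` (phonon scale below the electronic scale):

* `coulombPseudopotential_nonneg`, `coulombPseudopotential_le_bare` — `0 ≤ μ* ≤ V_c` (retardation only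
  weakens the repulsion);
* `coulombPseudopotential_lt_inv_log` — **the Morel–Anderson ceiling** `μ* < 1/ln(ε₀/Ω̃)` for EVERY bare
  `V_c ≥ 0` (the supremum `V_c → ∞`), with the corollaries `coulombPseudopotential_mul_log_lt_one`
  (`μ* · L < 1`) and `coulombPseudopotential_lt_inv_of_le_log` (a lower bound `c ≤ L` gives `μ* < 1/c`);
* `coulombPseudopotential_mono_bare` / `_mono_omega` / `_anti_eps` — `μ*` is monotone in `V_c`, monotone in
  the phonon cutoff `Ω̃` and antitone in the electronic scale `ε₀`;
* `coulombPseudopotential_rescale` — **change of cutoff**: referring the same `V_c` to two phonon cutoffs,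
  `μ*(Ω̃₂) = μ*(Ω̃₁) / (1 + μ*(Ω̃₁) ln(Ω̃₁/Ω̃₂))` (the Morel–Anderson map is a one-parameter semigroup in the
  logarithm of the cutoff), equivalently `1/μ*(Ω̃₂) − 1/μ*(Ω̃₁) = ln(Ω̃₁/Ω̃₂)`
  (`inv_coulombPseudopotential_sub`; `inv_coulombPseudopotential`: `1/μ* = 1/V_c + L`), and the inversion
  `coulombPseudopotential_div_eq_bare` (`V_c = μ*/(1 − μ* L)`);
* `allenDynesTc_coulomb_floor`, `mcMillanTc_coulomb_floor` — composing the ceiling with the antitonicity of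
  `T_c` in `μ*`: at fixed `(ω_log, r, λ)` the value of `T_c` at `μ* = 1/ln(ε₀/Ω̃)` is a floor UNIFORM in the
  bare Coulomb strength (when that value is still in the physical domain).

## Large-coupling behaviour (appended 2026-08-27, hubbard-downfold lit-4)

* `mcMillanExponent_ge_limit`, `mcMillanTc_le_saturation` — the McMillan exponent never falls below its
  `λ → ∞` limit `1.04/(1 − 0.62μ*)`, so at fixed `(ω, μ*)` the McMillan form is BOUNDED in `λ`:
  `T_c^{McM} ≤ (ω/1.2)·exp(−1.04/(1 − 0.62μ*))` («above [`λ ≈ 1.5`] it tends to saturate, underestimating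
  the true critical temperature», Flores-Livas et al. 2020 §3.2.4 on Fig. 15);
* `sqrt_le_allenDynesF1`, `sqrt_mul_mcMillanTc_le_allenDynesTc`, `allenDynesTc_unbounded` — Allen–Dynes'
  `f₁ = (1 + (λ/Λ₁)^{3/2})^{1/3} ≥ √(λ/Λ₁)`, hence `T_c^{AD} ≥ √(λ/Λ₁)·T_c^{McM}` and `T_c^{AD}` exceeds
  any prescribed temperature for `λ` large (the `λ^{1/2}` growth of the very-strong-coupling Eliashberg
  `T_c`, Kresin et al. §2.2.2 p. 110 «`T_c ∝ λ^{1/2}Ω̃`»; Allen–Dynes 1975). A sanity bound for pipelines: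
  a McMillan-form number above the saturation value is an arithmetic error; an Allen–Dynes number is not so
  bounded.

## The inverted McMillan formula (appended 2026-08-27, hubbard-downfold lit-4)

Specific-heat papers extract `λ_ep` from a measured `T_c` and Debye temperature by INVERTING the McMillan
form: «λ_ep can be calculated from the inverted McMillan's formula
λ_ep = (1.04 + μ* ln(Θ_D/1.45T_c)) / ((1 − 0.62μ*) ln(Θ_D/1.45T_c) − 1.04)» (Klimczuk et al. 2012, p. 10,
Table II: λ_ep = 0.70 / 0.58 / 0.52 for YPd₂Sn / LuPd₂Sn / ScPd₂Sn at μ* = 0.13; «using … 0.15 causes increase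
of λ_ep to 0.75»). Writing `L` for the logarithm `ln(θ/T_c)` of the prefactor temperature `θ` (`Θ_D/1.45` in
McMillan's normalisation, `ω/1.2` in the one used by `mcMillanTc`):

* `mcMillanLambdaInv L μ* = (1.04 + μ* L)/((1 − 0.62 μ*) L − 1.04)`;
* `mcMillanExponent_lambdaInv` — on the physical domain the exponent evaluated at `λ_inv` IS `L`, hence
  `mcMillanTc_lambdaInv`: `mcMillanTc ω (λ_inv(ln(ω/(1.2 T_c)), μ*)) μ* = T_c` (exact inverse);
* `mcMillanLambdaInv_anti_L` — at fixed `(T_c, μ*)`, `λ_inv` is STRICTLY DECREASING in `L`, i.e. in the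
  prefactor temperature: the same measured `T_c` read with a larger phonon scale needs a smaller `λ` (and a
  softer scale — `ω_log ≪ Θ_D` — a larger one); `mcMillanLambdaInv_mono_mu` — increasing in `μ*`;
* `mcMillanLambdaInv_klimczuk_window` — for every `L ∈ [3.42, 3.44]` (`ln(210/(1.45 × 4.7)) = ln 30.8`,
  YPd₂Sn) the inverted value lies in `(0.70, 0.71)` at `μ* = 0.13` and in `(0.74, 0.76)` at `μ* = 0.15`
  (printed 0.70 and 0.75); the logarithm itself is taken as the hypothesis interval, not evaluated here.

USE (hubbard-eph / the router's EPH packets): the empirical band `μ* ∈ [0.10, 0.16]` is a statement about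
`V_c` AND the cutoff; a `μ*` quoted at an Eliashberg cutoff `ω_c` and one entering the Allen–Dynes formula are
different numbers related by `coulombPseudopotential_rescale`; and a fitted `μ*` at or above `1/ln(ε₀/Ω̃)` is
outside the range of the Morel–Anderson map for every `V_c ≥ 0` (e.g. `L = 5 ⇒ μ* < 0.2`). Nothing here
asserts a value of `V_c`, `ε₀` or `Ω̃` for any material.
-/

noncomputable section

namespace Literature.MathematicalPhysics.QuantumManyBody

/-! ## The McMillan form -/

/-- The McMillan denominator ("net attractive coupling") `λ − μ*(1 + 0.62 λ)` entering the exponent of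
McMillan's `T_c` formula; the formula is meaningful only where it is positive.
[cite: Mcmillan1968, Eq. (18)] -/
def mcMillanDenom (lam mu : ℝ) : ℝ := lam - mu * (1 + 0.62 * lam)

/-- The McMillan exponent `1.04 (1 + λ) / (λ − μ*(1 + 0.62 λ))`, so that `T_c ∝ exp(−exponent)`.
[cite: Mcmillan1968, Eq. (18)] -/
def mcMillanExponent (lam mu : ℝ) : ℝ := 1.04 * (1 + lam) / mcMillanDenom lam mu

/-- **McMillan's `T_c` formula in the Allen–Dynes normalisation**:
`T_c(ω, λ, μ*) = (ω / 1.2) · exp(−1.04 (1 + λ) / (λ − μ*(1 + 0.62 λ)))`, where `ω` is the characteristic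
phonon scale (`ω_log` in Allen–Dynes' Eq. (34) with `f₁ f₂ = 1`; McMillan's original prefactor was `Θ_D/1.45`,
Dynes' `⟨ω⟩/1.20`). `T_c` carries the unit of `ω`.
[cite: AllenDynes1975, Eq. (34)] -/
def mcMillanTc (omega lam mu : ℝ) : ℝ := omega / 1.2 * Real.exp (-mcMillanExponent lam mu)

/-- The McMillan denominator written as an affine function of `λ`: `(1 − 0.62 μ*) λ − μ*`. [cite: Mcmillan1968, Eq. (18)] -/
theorem mcMillanDenom_eq (lam mu : ℝ) : mcMillanDenom lam mu = (1 - 0.62 * mu) * lam - mu := by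
  unfold mcMillanDenom; ring

/-- The McMillan denominator is monotone in `λ` as long as `0.62 μ* ≤ 1`. [cite: Mcmillan1968, Eq. (18)] -/
theorem mcMillanDenom_mono_lam {mu l₁ l₂ : ℝ} (hmu : 0.62 * mu ≤ 1) (h : l₁ ≤ l₂) :
    mcMillanDenom l₁ mu ≤ mcMillanDenom l₂ mu := by
  rw [mcMillanDenom_eq, mcMillanDenom_eq]
  nlinarith [mul_nonneg (sub_nonneg.2 hmu) (sub_nonneg.2 h)]

/-- The McMillan denominator is antitone in `μ*` for `λ ≥ 0`. [cite: Mcmillan1968, Eq. (18)] -/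
theorem mcMillanDenom_anti_mu {lam m₁ m₂ : ℝ} (hlam : 0 ≤ lam) (h : m₁ ≤ m₂) :
    mcMillanDenom lam m₂ ≤ mcMillanDenom lam m₁ := by
  unfold mcMillanDenom
  nlinarith [mul_nonneg (sub_nonneg.2 h) hlam]

/-- On the physical domain (`0 ≤ μ*`, `0.62 μ* ≤ 1`, denominator positive) the McMillan exponent is
antitone in `λ`: a larger coupling gives a smaller exponent. The computation is
`(1+λ₁)D(λ₂) − (1+λ₂)D(λ₁) = (1 − 0.62 μ* + μ*)(λ₂ − λ₁) ≥ 0`. [cite: Mcmillan1968, Eq. (18)] -/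
theorem mcMillanExponent_anti_lam {mu l₁ l₂ : ℝ} (hmu : 0 ≤ mu) (hmu' : 0.62 * mu ≤ 1)
    (hD : 0 < mcMillanDenom l₁ mu) (h : l₁ ≤ l₂) :
    mcMillanExponent l₂ mu ≤ mcMillanExponent l₁ mu := by
  have hD₂ : 0 < mcMillanDenom l₂ mu := lt_of_lt_of_le hD (mcMillanDenom_mono_lam hmu' h)
  unfold mcMillanExponent
  rw [div_le_div_iff₀ hD₂ hD, mcMillanDenom_eq, mcMillanDenom_eq]
  nlinarith [mul_nonneg (sub_nonneg.2 hmu') (sub_nonneg.2 h), mul_nonneg hmu (sub_nonneg.2 h)]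

/-- On the physical domain (`0 ≤ λ`, denominator positive) the McMillan exponent is monotone in `μ*`.
[cite: Mcmillan1968, Eq. (18)] -/
theorem mcMillanExponent_mono_mu {lam m₁ m₂ : ℝ} (hlam : 0 ≤ lam) (h : m₁ ≤ m₂)
    (hD : 0 < mcMillanDenom lam m₂) :
    mcMillanExponent lam m₁ ≤ mcMillanExponent lam m₂ := by
  have hD₁ : 0 < mcMillanDenom lam m₁ := lt_of_lt_of_le hD (mcMillanDenom_anti_mu hlam h)
  unfold mcMillanExponent
  rw [div_le_div_iff₀ hD₁ hD]
  have hnum : 0 ≤ 1.04 * (1 + lam) := by positivity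
  exact mul_le_mul_of_nonneg_left (mcMillanDenom_anti_mu hlam h) hnum

/-- `T_c ≥ 0` whenever the phonon scale is `≥ 0`. [cite: AllenDynes1975, Eq. (34)] -/
theorem mcMillanTc_nonneg {omega : ℝ} (lam mu : ℝ) (hω : 0 ≤ omega) : 0 ≤ mcMillanTc omega lam mu := by
  unfold mcMillanTc; positivity

/-- `T_c > 0` whenever the phonon scale is `> 0` (the formula never vanishes; "no superconductivity" is a
statement about its size, not a zero). [cite: AllenDynes1975, Eq. (34)] -/
theorem mcMillanTc_pos {omega : ℝ} (lam mu : ℝ) (hω : 0 < omega) : 0 < mcMillanTc omega lam mu := by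
  unfold mcMillanTc; positivity

/-- `T_c` is monotone (indeed linear) in the phonon scale `ω`. [cite: AllenDynes1975, Eq. (34)] -/
theorem mcMillanTc_mono_omega {ω₁ ω₂ : ℝ} (lam mu : ℝ) (h : ω₁ ≤ ω₂) :
    mcMillanTc ω₁ lam mu ≤ mcMillanTc ω₂ lam mu := by
  unfold mcMillanTc
  have hexp := Real.exp_pos (-mcMillanExponent lam mu)
  have h' : ω₁ / 1.2 ≤ ω₂ / 1.2 := div_le_div_of_nonneg_right h (by norm_num)
  exact mul_le_mul_of_nonneg_right h' hexp.le

/-- `T_c` is monotone increasing in the coupling `λ` on the physical domain. [cite: AllenDynes1975, Eq. (34)] -/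
theorem mcMillanTc_mono_lam {omega mu l₁ l₂ : ℝ} (hω : 0 ≤ omega) (hmu : 0 ≤ mu)
    (hmu' : 0.62 * mu ≤ 1) (hD : 0 < mcMillanDenom l₁ mu) (h : l₁ ≤ l₂) :
    mcMillanTc omega l₁ mu ≤ mcMillanTc omega l₂ mu := by
  unfold mcMillanTc
  have hg := mcMillanExponent_anti_lam hmu hmu' hD h
  have hexp : Real.exp (-mcMillanExponent l₁ mu) ≤ Real.exp (-mcMillanExponent l₂ mu) :=
    Real.exp_le_exp.2 (by linarith)
  exact mul_le_mul_of_nonneg_left hexp (by positivity)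

/-- `T_c` is monotone decreasing in the Coulomb pseudopotential `μ*` on the physical domain. [cite: AllenDynes1975, Eq. (34)] -/
theorem mcMillanTc_anti_mu {omega lam m₁ m₂ : ℝ} (hω : 0 ≤ omega) (hlam : 0 ≤ lam) (h : m₁ ≤ m₂)
    (hD : 0 < mcMillanDenom lam m₂) :
    mcMillanTc omega lam m₂ ≤ mcMillanTc omega lam m₁ := by
  unfold mcMillanTc
  have hg := mcMillanExponent_mono_mu hlam h hD
  have hexp : Real.exp (-mcMillanExponent lam m₂) ≤ Real.exp (-mcMillanExponent lam m₁) :=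
    Real.exp_le_exp.2 (by linarith)
  exact mul_le_mul_of_nonneg_left hexp (by positivity)

/-- **Box → band (McMillan form).** If `(ω, λ, μ*)` ranges over a box
`[ω₋, ω₊] × [λ₋, λ₊] × [μ₋, μ₊]` inside the physical domain (`0 ≤ ω₋`, `0 ≤ λ₋`, `0 ≤ μ₋`,
`0.62 μ₊ ≤ 1`, and the denominator is positive at the worst corner `(λ₋, μ₊)`), then `T_c` lies between
its value at the corner `(ω₋, λ₋, μ₊)` and its value at the corner `(ω₊, λ₊, μ₋)`. [cite: AllenDynes1975, Eq. (34)] -/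
theorem mcMillanTc_mem_Icc_of_mem_box {ωlo ωhi llo lhi mlo mhi ω lam mu : ℝ}
    (hωlo : 0 ≤ ωlo) (hllo : 0 ≤ llo) (hmlo : 0 ≤ mlo) (hmhi : 0.62 * mhi ≤ 1)
    (hD : 0 < mcMillanDenom llo mhi)
    (hω : ω ∈ Set.Icc ωlo ωhi) (hl : lam ∈ Set.Icc llo lhi) (hm : mu ∈ Set.Icc mlo mhi) :
    mcMillanTc ω lam mu ∈ Set.Icc (mcMillanTc ωlo llo mhi) (mcMillanTc ωhi lhi mlo) := by
  obtain ⟨hω₁, hω₂⟩ := hω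
  obtain ⟨hl₁, hl₂⟩ := hl
  obtain ⟨hm₁, hm₂⟩ := hm
  have hmu0 : 0 ≤ mu := le_trans hmlo hm₁
  have hmu' : 0.62 * mu ≤ 1 := by linarith
  have hmlo' : 0.62 * mlo ≤ 1 := by linarith
  have hlam0 : 0 ≤ lam := le_trans hllo hl₁
  have hωhi : 0 ≤ ωhi := le_trans hωlo (le_trans hω₁ hω₂)
  have hD1 : 0 < mcMillanDenom llo mu := lt_of_lt_of_le hD (mcMillanDenom_anti_mu hllo hm₂)
  have hD2 : 0 < mcMillanDenom lam mu := lt_of_lt_of_le hD1 (mcMillanDenom_mono_lam hmu' hl₁)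
  have hD3 : 0 < mcMillanDenom lhi mu := lt_of_lt_of_le hD2 (mcMillanDenom_mono_lam hmu' hl₂)
  constructor
  · calc mcMillanTc ωlo llo mhi ≤ mcMillanTc ωlo llo mu := mcMillanTc_anti_mu hωlo hllo hm₂ hD
      _ ≤ mcMillanTc ωlo lam mu := mcMillanTc_mono_lam hωlo hmu0 hmu' hD1 hl₁
      _ ≤ mcMillanTc ω lam mu := mcMillanTc_mono_omega lam mu hω₁
  · calc mcMillanTc ω lam mu ≤ mcMillanTc ωhi lam mu := mcMillanTc_mono_omega lam mu hω₂
      _ ≤ mcMillanTc ωhi lhi mu := mcMillanTc_mono_lam hωhi hmu0 hmu' hD2 hl₂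
      _ ≤ mcMillanTc ωhi lhi mlo := mcMillanTc_anti_mu hωhi (le_trans hlam0 hl₂) hm₁ hD3

/-! ## The Allen–Dynes correction factors -/

/-- Allen–Dynes' `Λ₁ = 2.46 (1 + 3.8 μ*)`. [cite: AllenDynes1975, Eq. (37)] -/
def allenDynesLambda1 (mu : ℝ) : ℝ := 2.46 * (1 + 3.8 * mu)

/-- Allen–Dynes' `Λ₂ = 1.82 (1 + 6.3 μ*) · (ω̄₂ / ω_log)`; the second argument is the ratio
`r = ω̄₂ / ω_log`. [cite: AllenDynes1975, Eq. (38)] -/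
def allenDynesLambda2 (mu r : ℝ) : ℝ := 1.82 * (1 + 6.3 * mu) * r

/-- Allen–Dynes' strong-coupling correction `f₁ = [1 + (λ/Λ₁)^{3/2}]^{1/3}`.
[cite: AllenDynes1975, Eq. (35)] -/
def allenDynesF1 (lam mu : ℝ) : ℝ :=
  (1 + (lam / allenDynesLambda1 mu) ^ ((3 : ℝ) / 2)) ^ ((1 : ℝ) / 3)

/-- Allen–Dynes' shape correction `f₂ = 1 + (ω̄₂/ω_log − 1) λ² / (λ² + Λ₂²)`, as a function of `λ`, `μ*` and
the ratio `r = ω̄₂ / ω_log`. [cite: AllenDynes1975, Eq. (36)] -/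
def allenDynesF2 (lam mu r : ℝ) : ℝ :=
  1 + (r - 1) * (lam ^ 2 / (lam ^ 2 + allenDynesLambda2 mu r ^ 2))

/-- **The Allen–Dynes `T_c` formula** `T_c^{AD}(ω_log, r, λ, μ*) = f₁ f₂ · (ω_log/1.2) ·
exp(−1.04 (1 + λ)/(λ − μ*(1 + 0.62 λ)))`, with `r = ω̄₂/ω_log`. [cite: AllenDynes1975, Eq. (34)] -/
def allenDynesTc (omegaLog r lam mu : ℝ) : ℝ :=
  allenDynesF1 lam mu * allenDynesF2 lam mu r * mcMillanTc omegaLog lam mu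

/-- `Λ₁ > 0` for `μ* ≥ 0`. [folklore] -/
private theorem allenDynesLambda1_pos {mu : ℝ} (hmu : 0 ≤ mu) : 0 < allenDynesLambda1 mu := by
  unfold allenDynesLambda1; positivity

/-- `Λ₁` is monotone in `μ*`. [folklore] -/
private theorem allenDynesLambda1_mono {m₁ m₂ : ℝ} (h : m₁ ≤ m₂) :
    allenDynesLambda1 m₁ ≤ allenDynesLambda1 m₂ := by
  unfold allenDynesLambda1; linarith

/-- `Λ₂ ≥ 0` for `μ* ≥ 0`, `r ≥ 0`. [folklore] -/
private theorem allenDynesLambda2_nonneg {mu r : ℝ} (hmu : 0 ≤ mu) (hr : 0 ≤ r) :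
    0 ≤ allenDynesLambda2 mu r := by
  unfold allenDynesLambda2; positivity

/-- `Λ₂` is monotone in `μ*` for `r ≥ 0`. [folklore] -/
private theorem allenDynesLambda2_mono_mu {r m₁ m₂ : ℝ} (hr : 0 ≤ r) (h : m₁ ≤ m₂) :
    allenDynesLambda2 m₁ r ≤ allenDynesLambda2 m₂ r := by
  unfold allenDynesLambda2
  nlinarith [mul_nonneg (sub_nonneg.2 h) hr]

/-- `f₁ ≥ 1` on the physical domain. [cite: AllenDynes1975, Eq. (35)] -/
theorem one_le_allenDynesF1 {lam mu : ℝ} (hlam : 0 ≤ lam) (hmu : 0 ≤ mu) :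
    1 ≤ allenDynesF1 lam mu := by
  unfold allenDynesF1
  have hb : 0 ≤ lam / allenDynesLambda1 mu := div_nonneg hlam (allenDynesLambda1_pos hmu).le
  have h1 : (1 : ℝ) ≤ 1 + (lam / allenDynesLambda1 mu) ^ ((3 : ℝ) / 2) :=
    le_add_of_nonneg_right (Real.rpow_nonneg hb _)
  exact Real.one_le_rpow h1 (by norm_num)

/-- `f₁ > 0` on the physical domain. [cite: AllenDynes1975, Eq. (35)] -/
theorem allenDynesF1_pos {lam mu : ℝ} (hlam : 0 ≤ lam) (hmu : 0 ≤ mu) : 0 < allenDynesF1 lam mu :=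
  lt_of_lt_of_le one_pos (one_le_allenDynesF1 hlam hmu)

/-- `f₁` is monotone increasing in `λ` (`λ ≥ 0`, `μ* ≥ 0`). [cite: AllenDynes1975, Eq. (35)] -/
theorem allenDynesF1_mono_lam {mu l₁ l₂ : ℝ} (hmu : 0 ≤ mu) (hl₁ : 0 ≤ l₁) (h : l₁ ≤ l₂) :
    allenDynesF1 l₁ mu ≤ allenDynesF1 l₂ mu := by
  unfold allenDynesF1
  have hΛ := allenDynesLambda1_pos hmu
  have hb₁ : 0 ≤ l₁ / allenDynesLambda1 mu := div_nonneg hl₁ hΛ.le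
  have hb : l₁ / allenDynesLambda1 mu ≤ l₂ / allenDynesLambda1 mu := by
    rw [div_le_div_iff₀ hΛ hΛ]
    exact mul_le_mul_of_nonneg_right h hΛ.le
  have hp : (l₁ / allenDynesLambda1 mu) ^ ((3 : ℝ) / 2) ≤ (l₂ / allenDynesLambda1 mu) ^ ((3 : ℝ) / 2) :=
    Real.rpow_le_rpow hb₁ hb (by norm_num)
  exact Real.rpow_le_rpow (add_nonneg zero_le_one (Real.rpow_nonneg hb₁ _)) (by linarith) (by norm_num)

/-- `f₁` is monotone decreasing in `μ*` (`λ ≥ 0`, `0 ≤ μ₁ ≤ μ₂`). [cite: AllenDynes1975, Eq. (35)] -/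
theorem allenDynesF1_anti_mu {lam m₁ m₂ : ℝ} (hlam : 0 ≤ lam) (hm₁ : 0 ≤ m₁) (h : m₁ ≤ m₂) :
    allenDynesF1 lam m₂ ≤ allenDynesF1 lam m₁ := by
  unfold allenDynesF1
  have hΛ₁ := allenDynesLambda1_pos hm₁
  have hΛ₂ := allenDynesLambda1_pos (hm₁.trans h)
  have hb₂ : 0 ≤ lam / allenDynesLambda1 m₂ := div_nonneg hlam hΛ₂.le
  have hb : lam / allenDynesLambda1 m₂ ≤ lam / allenDynesLambda1 m₁ := by
    rw [div_le_div_iff₀ hΛ₂ hΛ₁]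
    exact mul_le_mul_of_nonneg_left (allenDynesLambda1_mono h) hlam
  have hp : (lam / allenDynesLambda1 m₂) ^ ((3 : ℝ) / 2) ≤ (lam / allenDynesLambda1 m₁) ^ ((3 : ℝ) / 2) :=
    Real.rpow_le_rpow hb₂ hb (by norm_num)
  exact Real.rpow_le_rpow (add_nonneg zero_le_one (Real.rpow_nonneg hb₂ _)) (by linarith) (by norm_num)

/-- Auxiliary: `λ ↦ λ²/(λ² + c)` is monotone on `λ ≥ 0` for `c ≥ 0`. [folklore] -/
private theorem sq_div_sq_add_mono {c l₁ l₂ : ℝ} (hc : 0 ≤ c) (hl₁ : 0 ≤ l₁) (h : l₁ ≤ l₂) :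
    l₁ ^ 2 / (l₁ ^ 2 + c) ≤ l₂ ^ 2 / (l₂ ^ 2 + c) := by
  have hsq : l₁ ^ 2 ≤ l₂ ^ 2 := pow_le_pow_left₀ hl₁ h 2
  rcases eq_or_lt_of_le (add_nonneg (sq_nonneg l₁) hc) with h0 | hpos
  · rw [← h0, div_zero]
    exact div_nonneg (sq_nonneg _) (add_nonneg (sq_nonneg _) hc)
  · have hpos₂ : 0 < l₂ ^ 2 + c := lt_of_lt_of_le hpos (by linarith)
    rw [div_le_div_iff₀ hpos hpos₂]
    nlinarith [mul_le_mul_of_nonneg_left hsq hc]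

/-- Auxiliary: `c ↦ l²/(l² + c)` is antitone on `c ≥ 0`. [folklore] -/
private theorem sq_div_sq_add_anti {l c₁ c₂ : ℝ} (hc₁ : 0 ≤ c₁) (h : c₁ ≤ c₂) :
    l ^ 2 / (l ^ 2 + c₂) ≤ l ^ 2 / (l ^ 2 + c₁) := by
  rcases eq_or_lt_of_le (add_nonneg (sq_nonneg l) hc₁) with h0 | hpos
  · have hl : l ^ 2 = 0 := by nlinarith [sq_nonneg l]
    simp [hl]
  · exact div_le_div_of_nonneg_left (sq_nonneg l) hpos (by linarith)

/-- `f₂ ≥ 1` when `r = ω̄₂/ω_log ≥ 1` (always the case: `ω̄₂ ≥ ω_log` by Jensen's inequality).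
[cite: AllenDynes1975, Eq. (36)] -/
theorem one_le_allenDynesF2 (lam mu : ℝ) {r : ℝ} (hr : 1 ≤ r) : 1 ≤ allenDynesF2 lam mu r := by
  unfold allenDynesF2
  have : 0 ≤ (r - 1) * (lam ^ 2 / (lam ^ 2 + allenDynesLambda2 mu r ^ 2)) :=
    mul_nonneg (by linarith) (div_nonneg (sq_nonneg _) (by positivity))
  linarith

/-- `f₂` is monotone increasing in `λ` (`λ ≥ 0`, `r ≥ 1`). [cite: AllenDynes1975, Eq. (36)] -/
theorem allenDynesF2_mono_lam {mu r l₁ l₂ : ℝ} (hr : 1 ≤ r) (hl₁ : 0 ≤ l₁) (h : l₁ ≤ l₂) :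
    allenDynesF2 l₁ mu r ≤ allenDynesF2 l₂ mu r := by
  unfold allenDynesF2
  have hs := sq_div_sq_add_mono (sq_nonneg (allenDynesLambda2 mu r)) hl₁ h
  have := mul_le_mul_of_nonneg_left hs (by linarith : (0 : ℝ) ≤ r - 1)
  linarith

/-- `f₂` is monotone decreasing in `μ*` (`0 ≤ μ₁ ≤ μ₂`, `r ≥ 1`). [cite: AllenDynes1975, Eq. (36)] -/
theorem allenDynesF2_anti_mu {lam r m₁ m₂ : ℝ} (hr : 1 ≤ r) (hm₁ : 0 ≤ m₁) (h : m₁ ≤ m₂) :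
    allenDynesF2 lam m₂ r ≤ allenDynesF2 lam m₁ r := by
  unfold allenDynesF2
  have hr0 : 0 ≤ r := by linarith
  have hΛ : allenDynesLambda2 m₁ r ^ 2 ≤ allenDynesLambda2 m₂ r ^ 2 :=
    pow_le_pow_left₀ (allenDynesLambda2_nonneg hm₁ hr0) (allenDynesLambda2_mono_mu hr0 h) 2
  have hs := sq_div_sq_add_anti (l := lam) (sq_nonneg (allenDynesLambda2 m₁ r)) hΛ
  have := mul_le_mul_of_nonneg_left hs (by linarith : (0 : ℝ) ≤ r - 1)
  linarith

/-! ## Monotonicity of the Allen–Dynes `T_c` and the box → band statement -/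

/-- `T_c^{AD} ≥ 0` on the physical domain. [cite: AllenDynes1975, Eq. (34)] -/
theorem allenDynesTc_nonneg {omegaLog r lam mu : ℝ} (hω : 0 ≤ omegaLog) (hr : 1 ≤ r) (hlam : 0 ≤ lam)
    (hmu : 0 ≤ mu) : 0 ≤ allenDynesTc omegaLog r lam mu :=
  mul_nonneg (mul_nonneg (allenDynesF1_pos hlam hmu).le
    (zero_le_one.trans (one_le_allenDynesF2 lam mu hr))) (mcMillanTc_nonneg lam mu hω)

/-- `T_c^{AD} ≥ T_c^{McM}`: the Allen–Dynes factors only raise McMillan's estimate (`f₁, f₂ ≥ 1`).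
[cite: AllenDynes1975, Eq. (34)-(36)] -/
theorem mcMillanTc_le_allenDynesTc {omegaLog r lam mu : ℝ} (hω : 0 ≤ omegaLog) (hr : 1 ≤ r)
    (hlam : 0 ≤ lam) (hmu : 0 ≤ mu) : mcMillanTc omegaLog lam mu ≤ allenDynesTc omegaLog r lam mu := by
  unfold allenDynesTc
  have h1 := one_le_allenDynesF1 hlam hmu
  have h2 := one_le_allenDynesF2 lam mu hr
  have hT := mcMillanTc_nonneg lam mu hω
  have h12 : (1 : ℝ) ≤ allenDynesF1 lam mu * allenDynesF2 lam mu r := by nlinarith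
  nlinarith

/-- `T_c^{AD}` is monotone in `ω_log` at fixed `(r, λ, μ*)`. [cite: AllenDynes1975, Eq. (34)] -/
theorem allenDynesTc_mono_omega {ω₁ ω₂ r lam mu : ℝ} (hr : 1 ≤ r) (hlam : 0 ≤ lam) (hmu : 0 ≤ mu)
    (h : ω₁ ≤ ω₂) : allenDynesTc ω₁ r lam mu ≤ allenDynesTc ω₂ r lam mu := by
  unfold allenDynesTc
  exact mul_le_mul_of_nonneg_left (mcMillanTc_mono_omega lam mu h)
    (mul_nonneg (allenDynesF1_pos hlam hmu).le (zero_le_one.trans (one_le_allenDynesF2 lam mu hr)))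

/-- `T_c^{AD}` is monotone increasing in `λ` at fixed `(ω_log, r, μ*)` on the physical domain.
[cite: AllenDynes1975, Eq. (34)] -/
theorem allenDynesTc_mono_lam {omegaLog r mu l₁ l₂ : ℝ} (hω : 0 ≤ omegaLog) (hr : 1 ≤ r)
    (hmu : 0 ≤ mu) (hmu' : 0.62 * mu ≤ 1) (hl₁ : 0 ≤ l₁) (hD : 0 < mcMillanDenom l₁ mu)
    (h : l₁ ≤ l₂) : allenDynesTc omegaLog r l₁ mu ≤ allenDynesTc omegaLog r l₂ mu := by
  unfold allenDynesTc
  have hl₂ : 0 ≤ l₂ := hl₁.trans h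
  have hF : allenDynesF1 l₁ mu * allenDynesF2 l₁ mu r ≤ allenDynesF1 l₂ mu * allenDynesF2 l₂ mu r :=
    mul_le_mul (allenDynesF1_mono_lam hmu hl₁ h) (allenDynesF2_mono_lam hr hl₁ h)
      (zero_le_one.trans (one_le_allenDynesF2 l₁ mu hr)) (allenDynesF1_pos hl₂ hmu).le
  exact mul_le_mul hF (mcMillanTc_mono_lam hω hmu hmu' hD h) (mcMillanTc_nonneg l₁ mu hω)
    (mul_nonneg (allenDynesF1_pos hl₂ hmu).le (zero_le_one.trans (one_le_allenDynesF2 l₂ mu hr)))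

/-- `T_c^{AD}` is monotone decreasing in `μ*` at fixed `(ω_log, r, λ)` on the physical domain.
[cite: AllenDynes1975, Eq. (34)] -/
theorem allenDynesTc_anti_mu {omegaLog r lam m₁ m₂ : ℝ} (hω : 0 ≤ omegaLog) (hr : 1 ≤ r)
    (hlam : 0 ≤ lam) (hm₁ : 0 ≤ m₁) (h : m₁ ≤ m₂) (hD : 0 < mcMillanDenom lam m₂) :
    allenDynesTc omegaLog r lam m₂ ≤ allenDynesTc omegaLog r lam m₁ := by
  unfold allenDynesTc
  have hm₂ : 0 ≤ m₂ := hm₁.trans h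
  have hF : allenDynesF1 lam m₂ * allenDynesF2 lam m₂ r ≤ allenDynesF1 lam m₁ * allenDynesF2 lam m₁ r :=
    mul_le_mul (allenDynesF1_anti_mu hlam hm₁ h) (allenDynesF2_anti_mu hr hm₁ h)
      (zero_le_one.trans (one_le_allenDynesF2 lam m₂ hr)) (allenDynesF1_pos hlam hm₁).le
  exact mul_le_mul hF (mcMillanTc_anti_mu hω hlam h hD) (mcMillanTc_nonneg lam m₂ hω)
    (mul_nonneg (allenDynesF1_pos hlam hm₁).le (zero_le_one.trans (one_le_allenDynesF2 lam m₁ hr)))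

/-- **Box → band (Allen–Dynes form, fixed shape ratio `r`).** If `(ω_log, λ, μ*)` ranges over a box
`[ω₋, ω₊] × [λ₋, λ₊] × [μ₋, μ₊]` inside the physical domain (`0 ≤ ω₋`, `0 ≤ λ₋`, `0 ≤ μ₋`, `0.62 μ₊ ≤ 1`,
`1 ≤ r`, denominator positive at the worst corner `(λ₋, μ₊)`), then `T_c^{AD}` lies between its values at
the corners `(ω₋, λ₋, μ₊)` and `(ω₊, λ₊, μ₋)`. [cite: AllenDynes1975, Eq. (34)] -/
theorem allenDynesTc_mem_Icc_of_mem_box {ωlo ωhi llo lhi mlo mhi r ω lam mu : ℝ}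
    (hωlo : 0 ≤ ωlo) (hllo : 0 ≤ llo) (hmlo : 0 ≤ mlo) (hmhi : 0.62 * mhi ≤ 1) (hr : 1 ≤ r)
    (hD : 0 < mcMillanDenom llo mhi)
    (hω : ω ∈ Set.Icc ωlo ωhi) (hl : lam ∈ Set.Icc llo lhi) (hm : mu ∈ Set.Icc mlo mhi) :
    allenDynesTc ω r lam mu ∈ Set.Icc (allenDynesTc ωlo r llo mhi) (allenDynesTc ωhi r lhi mlo) := by
  obtain ⟨hω₁, hω₂⟩ := hω
  obtain ⟨hl₁, hl₂⟩ := hl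
  obtain ⟨hm₁, hm₂⟩ := hm
  have hmu0 : 0 ≤ mu := le_trans hmlo hm₁
  have hmu' : 0.62 * mu ≤ 1 := by linarith
  have hlam0 : 0 ≤ lam := le_trans hllo hl₁
  have hlhi : 0 ≤ lhi := hlam0.trans hl₂
  have hωhi : 0 ≤ ωhi := le_trans hωlo (le_trans hω₁ hω₂)
  have hD1 : 0 < mcMillanDenom llo mu := lt_of_lt_of_le hD (mcMillanDenom_anti_mu hllo hm₂)
  have hD2 : 0 < mcMillanDenom lam mu := lt_of_lt_of_le hD1 (mcMillanDenom_mono_lam hmu' hl₁)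
  have hD3 : 0 < mcMillanDenom lhi mu := lt_of_lt_of_le hD2 (mcMillanDenom_mono_lam hmu' hl₂)
  constructor
  · calc allenDynesTc ωlo r llo mhi
        ≤ allenDynesTc ωlo r llo mu := allenDynesTc_anti_mu hωlo hr hllo hmu0 hm₂ hD
      _ ≤ allenDynesTc ωlo r lam mu := allenDynesTc_mono_lam hωlo hr hmu0 hmu' hllo hD1 hl₁
      _ ≤ allenDynesTc ω r lam mu := allenDynesTc_mono_omega hr hlam0 hmu0 hω₁
  · calc allenDynesTc ω r lam mu
        ≤ allenDynesTc ωhi r lam mu := allenDynesTc_mono_omega hr hlam0 hmu0 hω₂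
      _ ≤ allenDynesTc ωhi r lhi mu := allenDynesTc_mono_lam hωhi hr hmu0 hmu' hlam0 hD2 hl₂
      _ ≤ allenDynesTc ωhi r lhi mlo := allenDynesTc_anti_mu hωhi hr hlhi hmlo hm₁ hD3

/-! ## Isotope scaling: homogeneity in the phonon scale and the harmonic isotope exponent `α = 1/2` -/

/-- `T_c` (McMillan form) is linear — degree-1 homogeneous — in the phonon scale at fixed `(λ, μ*)`.
[cite: AllenDynes1975, Eq. (34) (prefactor `ω_log/1.2`)] -/
theorem mcMillanTc_mul_omega (c omega lam mu : ℝ) :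
    mcMillanTc (c * omega) lam mu = c * mcMillanTc omega lam mu := by
  unfold mcMillanTc
  ring

/-- `T_c^{AD}` is degree-1 homogeneous in `ω_log` at fixed `(r, λ, μ*)` (`f₁`, `f₂` depend on `ω̄₂` only
through the ratio `r = ω̄₂/ω_log`). [cite: AllenDynes1975, Eq. (34)] -/
theorem allenDynesTc_mul_omega (c omegaLog r lam mu : ℝ) :
    allenDynesTc (c * omegaLog) r lam mu = c * allenDynesTc omegaLog r lam mu := by
  unfold allenDynesTc
  rw [mcMillanTc_mul_omega]
  ring

/-- `M^{−1/2} · √M = 1` for `M > 0`. [folklore] -/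
private theorem rpow_neg_half_mul_sqrt {M : ℝ} (hM : 0 < M) : M ^ (-(1 / 2 : ℝ)) * Real.sqrt M = 1 := by
  rw [Real.sqrt_eq_rpow, ← Real.rpow_add hM]
  norm_num

/-- **Harmonic isotope scaling, Allen–Dynes form.** If every phonon frequency scales as `M^{−1/2}`
(`ω_log = κ · M^{−1/2}`, `r`, `λ`, `μ*` mass-independent), then `T_c(M) · √M` is independent of the ionic
mass `M`: `T_c = const · M^{−α}` with `α = 1/2`.
[cite: KresinMorawitzWolf2013, §3.5 Eq. (3.81) («α ≈ 0.5 … since the vibrational frequency Ω̃ ∝ M^{−1/2}»); AllenDynes1975, Eq. (34)] -/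
theorem allenDynesTc_isotope_invariant (κ r lam mu : ℝ) {M₁ M₂ : ℝ} (hM₁ : 0 < M₁) (hM₂ : 0 < M₂) :
    allenDynesTc (κ * M₂ ^ (-(1 / 2 : ℝ))) r lam mu * Real.sqrt M₂
      = allenDynesTc (κ * M₁ ^ (-(1 / 2 : ℝ))) r lam mu * Real.sqrt M₁ := by
  rw [mul_comm κ (M₂ ^ _), mul_comm κ (M₁ ^ _), allenDynesTc_mul_omega, allenDynesTc_mul_omega]
  calc M₂ ^ (-(1 / 2 : ℝ)) * allenDynesTc κ r lam mu * Real.sqrt M₂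
      = allenDynesTc κ r lam mu * (M₂ ^ (-(1 / 2 : ℝ)) * Real.sqrt M₂) := by ring
    _ = allenDynesTc κ r lam mu * (M₁ ^ (-(1 / 2 : ℝ)) * Real.sqrt M₁) := by
        rw [rpow_neg_half_mul_sqrt hM₂, rpow_neg_half_mul_sqrt hM₁]
    _ = M₁ ^ (-(1 / 2 : ℝ)) * allenDynesTc κ r lam mu * Real.sqrt M₁ := by ring

/-- The same invariance for the McMillan form. [cite: KresinMorawitzWolf2013, §3.5 Eq. (3.81); AllenDynes1975, Eq. (34)] -/
theorem mcMillanTc_isotope_invariant (κ lam mu : ℝ) {M₁ M₂ : ℝ} (hM₁ : 0 < M₁) (hM₂ : 0 < M₂) :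
    mcMillanTc (κ * M₂ ^ (-(1 / 2 : ℝ))) lam mu * Real.sqrt M₂
      = mcMillanTc (κ * M₁ ^ (-(1 / 2 : ℝ))) lam mu * Real.sqrt M₁ := by
  rw [mul_comm κ (M₂ ^ _), mul_comm κ (M₁ ^ _), mcMillanTc_mul_omega, mcMillanTc_mul_omega]
  calc M₂ ^ (-(1 / 2 : ℝ)) * mcMillanTc κ lam mu * Real.sqrt M₂
      = mcMillanTc κ lam mu * (M₂ ^ (-(1 / 2 : ℝ)) * Real.sqrt M₂) := by ring
    _ = mcMillanTc κ lam mu * (M₁ ^ (-(1 / 2 : ℝ)) * Real.sqrt M₁) := by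
        rw [rpow_neg_half_mul_sqrt hM₂, rpow_neg_half_mul_sqrt hM₁]
    _ = M₁ ^ (-(1 / 2 : ℝ)) * mcMillanTc κ lam mu * Real.sqrt M₁ := by ring

/-- **Isotope ratio**: under harmonic scaling `T_c(M₂) / T_c(M₁) = √(M₁ / M₂)` whenever `T_c(M₁) ≠ 0`
(e.g. full H → D substitution in a hydrogen-dominated spectrum: ratio `1/√2`).
[cite: KresinMorawitzWolf2013, §3.5 Eq. (3.81) (α = 0.5); AllenDynes1975, Eq. (34)] -/
theorem allenDynesTc_isotope_ratio (κ r lam mu : ℝ) {M₁ M₂ : ℝ} (hM₁ : 0 < M₁) (hM₂ : 0 < M₂)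
    (hT : allenDynesTc (κ * M₁ ^ (-(1 / 2 : ℝ))) r lam mu ≠ 0) :
    allenDynesTc (κ * M₂ ^ (-(1 / 2 : ℝ))) r lam mu / allenDynesTc (κ * M₁ ^ (-(1 / 2 : ℝ))) r lam mu
      = Real.sqrt (M₁ / M₂) := by
  have h := allenDynesTc_isotope_invariant κ r lam mu hM₁ hM₂
  have hs₂ : 0 < Real.sqrt M₂ := Real.sqrt_pos.mpr hM₂
  rw [Real.sqrt_div' M₁ hM₂.le, div_eq_div_iff hT hs₂.ne']
  linarith [h]

/-- **The isotope coefficient as a logarithmic derivative exists**: with `ω_log = κ · M^{−1/2}` the map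
`M ↦ T_c^{AD}` is differentiable at every `M > 0` with derivative `T_c^{AD}(κ) · (−½) M^{−3/2}`.
[cite: KresinMorawitzWolf2013, §3.5 Eqs. (3.82)–(3.83) (`α = −(M/T_c)(∂T_c/∂Ω)(∂Ω/∂M)`); AllenDynes1975, Eq. (34)] -/
theorem allenDynesTc_isotope_hasDerivAt (κ r lam mu : ℝ) {M : ℝ} (hM : 0 < M) :
    HasDerivAt (fun m : ℝ => allenDynesTc (κ * m ^ (-(1 / 2 : ℝ))) r lam mu)
      (allenDynesTc κ r lam mu * (-(1 / 2 : ℝ) * M ^ (-(1 / 2 : ℝ) - 1))) M := by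
  have h1 : HasDerivAt (fun m : ℝ => m ^ (-(1 / 2 : ℝ))) (-(1 / 2 : ℝ) * M ^ (-(1 / 2 : ℝ) - 1)) M :=
    Real.hasDerivAt_rpow_const (Or.inl hM.ne')
  have h2 := h1.const_mul (allenDynesTc κ r lam mu)
  have hfun : (fun m : ℝ => allenDynesTc (κ * m ^ (-(1 / 2 : ℝ))) r lam mu)
      = fun m : ℝ => allenDynesTc κ r lam mu * m ^ (-(1 / 2 : ℝ)) := by
    funext m
    rw [mul_comm κ, allenDynesTc_mul_omega, mul_comm]
  rw [hfun]
  exact h2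

/-- **`α = 1/2` exactly under harmonic scaling**: the isotope coefficient
`α = −(M/T_c) · ∂T_c/∂M` (Kresin et al. Eq. (3.82)) evaluated with the derivative of
`allenDynesTc_isotope_hasDerivAt` equals `1/2` for every `M > 0` at which `T_c ≠ 0` — independently of
`λ`, `μ*`, `r` as long as these do not depend on `M`. Deviations of a measured `α` from `1/2` therefore
measure exactly the mass dependence of `(λ, μ*, r)` (anharmonicity, `μ*(Ω)`, multi-ion spectra) and nothing else.
[cite: KresinMorawitzWolf2013, §3.5 Eqs. (3.81)–(3.83); AllenDynes1975, Eq. (34)] -/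
theorem allenDynesTc_isotope_exponent (κ r lam mu : ℝ) {M : ℝ} (hM : 0 < M)
    (hT : allenDynesTc κ r lam mu ≠ 0) :
    -(M / allenDynesTc (κ * M ^ (-(1 / 2 : ℝ))) r lam mu)
        * (allenDynesTc κ r lam mu * (-(1 / 2 : ℝ) * M ^ (-(1 / 2 : ℝ) - 1))) = 1 / 2 := by
  rw [mul_comm κ, allenDynesTc_mul_omega]
  have hMpow : M ^ (-(1 / 2 : ℝ)) ≠ 0 := (Real.rpow_pos_of_pos hM _).ne'
  have hsplit : M ^ (-(1 / 2 : ℝ) - 1) = M ^ (-(1 / 2 : ℝ)) * M⁻¹ := by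
    rw [Real.rpow_sub hM, Real.rpow_one, div_eq_mul_inv]
  rw [hsplit]
  field_simp

/-! ## The `μ*(Ω̃)` correction to the isotope coefficient (Kresin–Morawitz–Wolf, Eq. (3.84)) -/

/-- The Coulomb pseudopotential with its dependence on the phonon scale,
`μ*(Ω̃) = V_c / (1 + V_c ln(ε₀/Ω̃))`. [cite: KresinMorawitzWolf2013, §2.2.2 Eq. (2.27)] -/
def coulombPseudopotential (Vc ε0 Ω : ℝ) : ℝ := Vc / (1 + Vc * Real.log (ε0 / Ω))

/-- The weak-coupling (BCS-type) transition temperature with the `Ω̃`-dependent pseudopotential,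
`T_c(Ω̃) = a Ω̃ exp(−1/(λ − μ*(Ω̃)))` (`a ≃ 0.25`; `a` is kept as a parameter).
[cite: KresinMorawitzWolf2013, §2.2.1 Eq. (2.21) with Eq. (2.27)] -/
def weakCouplingTc (a lam Vc ε0 Ω : ℝ) : ℝ :=
  a * Ω * Real.exp (-1 / (lam - coulombPseudopotential Vc ε0 Ω))

/-- `dμ*/dΩ̃ = μ*² / Ω̃`: the pseudopotential grows with the phonon scale. [cite: KresinMorawitzWolf2013, Eq. (2.27)] -/
theorem coulombPseudopotential_hasDerivAt {Vc ε0 Ω : ℝ} (hε : 0 < ε0) (hΩ : 0 < Ω)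
    (hden : 1 + Vc * Real.log (ε0 / Ω) ≠ 0) :
    HasDerivAt (fun x : ℝ => coulombPseudopotential Vc ε0 x)
      (coulombPseudopotential Vc ε0 Ω ^ 2 / Ω) Ω := by
  -- `x ↦ ε0 / x` and its logarithm
  have hq : HasDerivAt (fun x : ℝ => ε0 / x) (-ε0 / Ω ^ 2) Ω := by
    have h := ((hasDerivAt_inv hΩ.ne').const_mul ε0).congr_deriv (by field_simp : ε0 * -(Ω ^ 2)⁻¹ = -ε0 / Ω ^ 2)
    have hfun : (fun x : ℝ => ε0 / x) = fun x : ℝ => ε0 * x⁻¹ := by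
      funext x; rw [div_eq_mul_inv]
    rw [hfun]
    exact h
  have hqΩ : ε0 / Ω ≠ 0 := (div_pos hε hΩ).ne'
  have hlog : HasDerivAt (fun x : ℝ => Real.log (ε0 / x)) ((-ε0 / Ω ^ 2) / (ε0 / Ω)) Ω := hq.log hqΩ
  have hd : HasDerivAt (fun x : ℝ => 1 + Vc * Real.log (ε0 / x))
      (Vc * ((-ε0 / Ω ^ 2) / (ε0 / Ω))) Ω := (hlog.const_mul Vc).const_add 1
  have hμ : HasDerivAt (fun x : ℝ => Vc / (1 + Vc * Real.log (ε0 / x)))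
      ((0 * (1 + Vc * Real.log (ε0 / Ω)) - Vc * (Vc * ((-ε0 / Ω ^ 2) / (ε0 / Ω))))
        / (1 + Vc * Real.log (ε0 / Ω)) ^ 2) Ω := (hasDerivAt_const Ω Vc).fun_div hd hden
  unfold coulombPseudopotential
  refine hμ.congr_deriv ?_
  field_simp
  ring

/-- **Kresin–Morawitz–Wolf Eq. (3.84) as a derivative statement.** With `μ* = μ*(Ω̃)` of Eq. (2.27),
`dT_c/dΩ̃ = (T_c/Ω̃) · (1 − (μ*/(λ − μ*))²)`; i.e. the logarithmic derivative `(Ω̃/T_c) ∂T_c/∂Ω̃` is reduced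
from `1` to `1 − (μ*/(λ − μ*))²` by the phonon-scale dependence of `μ*`.
[cite: KresinMorawitzWolf2013, §3.5 Eqs. (3.83)–(3.84) with Eqs. (2.21), (2.27)] -/
theorem weakCouplingTc_hasDerivAt {a lam Vc ε0 Ω : ℝ} (hε : 0 < ε0) (hΩ : 0 < Ω)
    (hden : 1 + Vc * Real.log (ε0 / Ω) ≠ 0) (hgap : lam - coulombPseudopotential Vc ε0 Ω ≠ 0) :
    HasDerivAt (fun x : ℝ => weakCouplingTc a lam Vc ε0 x)
      (weakCouplingTc a lam Vc ε0 Ω / Ω *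
        (1 - (coulombPseudopotential Vc ε0 Ω / (lam - coulombPseudopotential Vc ε0 Ω)) ^ 2)) Ω := by
  have hμ := coulombPseudopotential_hasDerivAt (Vc := Vc) hε hΩ hden
  -- the gap `λ − μ*(x)` and the exponent `−1/(λ − μ*(x))`
  have hg : HasDerivAt (fun x : ℝ => lam - coulombPseudopotential Vc ε0 x)
      (0 - coulombPseudopotential Vc ε0 Ω ^ 2 / Ω) Ω :=
    (hasDerivAt_const Ω lam).fun_sub hμ
  have hexpArg : HasDerivAt (fun x : ℝ => -1 / (lam - coulombPseudopotential Vc ε0 x))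
      ((0 * (lam - coulombPseudopotential Vc ε0 Ω)
          - (-1) * (0 - coulombPseudopotential Vc ε0 Ω ^ 2 / Ω))
        / (lam - coulombPseudopotential Vc ε0 Ω) ^ 2) Ω :=
    (hasDerivAt_const Ω (-1 : ℝ)).fun_div hg hgap
  have hexp := hexpArg.exp
  have hlin : HasDerivAt (fun x : ℝ => a * x) (a * 1) Ω := (hasDerivAt_id Ω).const_mul a
  have hprod := hlin.fun_mul hexp
  unfold weakCouplingTc
  refine hprod.congr_deriv ?_
  field_simp
  ring

/-- **The isotope coefficient with the `μ*` correction, `α = ½ · [1 − (μ*/(λ − μ*))²]`** (Eq. (3.84) with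
`α|_{μ*=0} = ½`): composing Eq. (3.84)'s `Ω̃`-derivative with the harmonic scaling `Ω̃ = κ M^{−1/2}`
(`∂Ω̃/∂M = −½ κ M^{−3/2}`), the logarithmic mass derivative `α = −(M/T_c) · (∂T_c/∂Ω̃) · (∂Ω̃/∂M)`
(Eq. (3.83)) equals `½ (1 − s²)`, `s = μ*/(λ − μ*)`, exactly. Stated as the algebraic identity on the two
chain-rule factors (the `Ω̃`-derivative value of `weakCouplingTc_hasDerivAt` with `T = T_c(Ω̃)`, and the
`M`-derivative of `κ M^{−1/2}`); see `weakCouplingTc_isotope_hasDerivAt` for the chain rule itself.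
[cite: KresinMorawitzWolf2013, §3.5 Eqs. (3.82)–(3.84)] -/
theorem isotopeExponent_with_muStar {κ M T : ℝ} (s : ℝ) (hκ : κ ≠ 0) (hM : 0 < M) (hT : T ≠ 0) :
    -(M / T) * ((T / (κ * M ^ (-(1 / 2 : ℝ))) * (1 - s ^ 2)) * (κ * (-(1 / 2 : ℝ) * M ^ (-(1 / 2 : ℝ) - 1))))
      = 1 / 2 * (1 - s ^ 2) := by
  have hMpow : M ^ (-(1 / 2 : ℝ)) ≠ 0 := (Real.rpow_pos_of_pos hM _).ne'
  have hsplit : M ^ (-(1 / 2 : ℝ) - 1) = M ^ (-(1 / 2 : ℝ)) * M⁻¹ := by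
    rw [Real.rpow_sub hM, Real.rpow_one, div_eq_mul_inv]
  rw [hsplit]
  field_simp

/-- The chain rule behind Eq. (3.83): with `Ω̃(M) = κ M^{−1/2}` the mass derivative of `T_c` is the product of
the `Ω̃`-derivative of Eq. (3.84) and `∂Ω̃/∂M = κ · (−½) M^{−3/2}`.
[cite: KresinMorawitzWolf2013, §3.5 Eq. (3.83)] -/
theorem weakCouplingTc_isotope_hasDerivAt {a lam Vc ε0 κ M : ℝ} (hε : 0 < ε0) (hκ : 0 < κ) (hM : 0 < M)
    (hden : 1 + Vc * Real.log (ε0 / (κ * M ^ (-(1 / 2 : ℝ)))) ≠ 0)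
    (hgap : lam - coulombPseudopotential Vc ε0 (κ * M ^ (-(1 / 2 : ℝ))) ≠ 0) :
    HasDerivAt (fun m : ℝ => weakCouplingTc a lam Vc ε0 (κ * m ^ (-(1 / 2 : ℝ))))
      (weakCouplingTc a lam Vc ε0 (κ * M ^ (-(1 / 2 : ℝ))) / (κ * M ^ (-(1 / 2 : ℝ))) *
          (1 - (coulombPseudopotential Vc ε0 (κ * M ^ (-(1 / 2 : ℝ))) /
                (lam - coulombPseudopotential Vc ε0 (κ * M ^ (-(1 / 2 : ℝ))))) ^ 2) *
        (κ * (-(1 / 2 : ℝ) * M ^ (-(1 / 2 : ℝ) - 1)))) M := by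
  have hΩ : 0 < κ * M ^ (-(1 / 2 : ℝ)) := mul_pos hκ (Real.rpow_pos_of_pos hM _)
  have houter := weakCouplingTc_hasDerivAt (a := a) hε hΩ hden hgap
  have hinner : HasDerivAt (fun m : ℝ => κ * m ^ (-(1 / 2 : ℝ)))
      (κ * (-(1 / 2 : ℝ) * M ^ (-(1 / 2 : ℝ) - 1))) M :=
    (Real.hasDerivAt_rpow_const (Or.inl hM.ne')).const_mul κ
  have hcomp := houter.comp M hinner
  simpa only [Function.comp_def] using hcomp

/-! ## The Morel–Anderson pseudopotential: ceiling, monotonicity and change of cutoff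
(appended 2026-08-27, hubbard-downfold lit-4)

Algebra of the printed map `μ*(Ω̃) = V_c / (1 + V_c ln(ε₀/Ω̃))` (`coulombPseudopotential`). Physical domain:
`V_c ≥ 0`, `0 < Ω̃ < ε₀`, so that the retardation logarithm `L = ln(ε₀/Ω̃)` is positive. -/

/-- The retardation logarithm `ln(ε₀/Ω̃)` is positive exactly in the adiabatic situation `0 < Ω̃ < ε₀`
(phonon scale below the electronic scale). [cite: KresinMorawitzWolf2013, §2.2.2 Eq. (2.27)] -/
theorem retardationLog_pos {ε0 Ω : ℝ} (hΩ : 0 < Ω) (h : Ω < ε0) : 0 < Real.log (ε0 / Ω) :=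
  Real.log_pos ((one_lt_div hΩ).mpr h)

/-- `0 ≤ μ*` for `V_c ≥ 0`, `ln(ε₀/Ω̃) ≥ 0`. [cite: KresinMorawitzWolf2013, §2.2.2 Eq. (2.27)] -/
theorem coulombPseudopotential_nonneg {Vc ε0 Ω : ℝ} (hV : 0 ≤ Vc) (hL : 0 ≤ Real.log (ε0 / Ω)) :
    0 ≤ coulombPseudopotential Vc ε0 Ω := by
  unfold coulombPseudopotential
  have h1 : 0 < 1 + Vc * Real.log (ε0 / Ω) := by
    have := mul_nonneg hV hL; linarith
  exact div_nonneg hV h1.le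

/-- `μ* ≤ V_c`: retardation only weakens the Coulomb repulsion («the large logarithmic factor … reduces the
contribution of the Coulomb repulsion»). [cite: KresinMorawitzWolf2013, §2.2.2 Eq. (2.27)] -/
theorem coulombPseudopotential_le_bare {Vc ε0 Ω : ℝ} (hV : 0 ≤ Vc) (hL : 0 ≤ Real.log (ε0 / Ω)) :
    coulombPseudopotential Vc ε0 Ω ≤ Vc := by
  unfold coulombPseudopotential
  have hVL : 0 ≤ Vc * Real.log (ε0 / Ω) := mul_nonneg hV hL
  have h1 : 0 < 1 + Vc * Real.log (ε0 / Ω) := by linarith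
  rw [div_le_iff₀ h1]
  nlinarith [mul_nonneg hV hVL]

/-- **The Morel–Anderson ceiling.** For EVERY bare Coulomb strength `V_c ≥ 0` the pseudopotential stays
strictly below the reciprocal retardation logarithm, `μ*(Ω̃) < 1 / ln(ε₀/Ω̃)` (the value approached as
`V_c → ∞`): the map `V_c ↦ V_c/(1 + V_c L)` is bounded by `1/L`.
[cite: KresinMorawitzWolf2013, §2.2.2 Eq. (2.27); FloreslivasEtAl2020, §3.2.3 Eq. (59)] -/
theorem coulombPseudopotential_lt_inv_log {Vc ε0 Ω : ℝ} (hV : 0 ≤ Vc) (hL : 0 < Real.log (ε0 / Ω)) :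
    coulombPseudopotential Vc ε0 Ω < 1 / Real.log (ε0 / Ω) := by
  unfold coulombPseudopotential
  have h1 : 0 < 1 + Vc * Real.log (ε0 / Ω) := by
    have := mul_nonneg hV hL.le; linarith
  rw [div_lt_div_iff₀ h1 hL]
  linarith

/-- Equivalent form of the ceiling: `μ* · ln(ε₀/Ω̃) < 1`. [cite: KresinMorawitzWolf2013, §2.2.2 Eq. (2.27)] -/
theorem coulombPseudopotential_mul_log_lt_one {Vc ε0 Ω : ℝ} (hV : 0 ≤ Vc) (hL : 0 ≤ Real.log (ε0 / Ω)) :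
    coulombPseudopotential Vc ε0 Ω * Real.log (ε0 / Ω) < 1 := by
  unfold coulombPseudopotential
  have hVL : 0 ≤ Vc * Real.log (ε0 / Ω) := mul_nonneg hV hL
  have h1 : 0 < 1 + Vc * Real.log (ε0 / Ω) := by linarith
  rw [div_mul_eq_mul_div, div_lt_one h1]
  linarith

/-- The ceiling from a LOWER bound on the retardation logarithm: `0 < c ≤ ln(ε₀/Ω̃)` gives `μ* < 1/c` for every
`V_c ≥ 0` (e.g. `ln(ε₀/Ω̃) ≥ 5` forces `μ* < 0.2`). [cite: KresinMorawitzWolf2013, §2.2.2 Eq. (2.27); FloreslivasEtAl2020, §3.2.3 Eq. (59)] -/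
theorem coulombPseudopotential_lt_inv_of_le_log {Vc ε0 Ω c : ℝ} (hV : 0 ≤ Vc) (hc : 0 < c)
    (hcL : c ≤ Real.log (ε0 / Ω)) : coulombPseudopotential Vc ε0 Ω < 1 / c :=
  (coulombPseudopotential_lt_inv_log hV (hc.trans_le hcL)).trans_le (one_div_le_one_div_of_le hc hcL)

/-- `μ*` is monotone increasing in the bare Coulomb strength `V_c` (on `V_c ≥ 0`, `L ≥ 0`).
[cite: KresinMorawitzWolf2013, §2.2.2 Eq. (2.27)] -/
theorem coulombPseudopotential_mono_bare {V₁ V₂ ε0 Ω : ℝ} (hL : 0 ≤ Real.log (ε0 / Ω)) (hV₁ : 0 ≤ V₁)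
    (h : V₁ ≤ V₂) : coulombPseudopotential V₁ ε0 Ω ≤ coulombPseudopotential V₂ ε0 Ω := by
  unfold coulombPseudopotential
  have h1 : 0 < 1 + V₁ * Real.log (ε0 / Ω) := by
    have := mul_nonneg hV₁ hL; linarith
  have h2 : 0 < 1 + V₂ * Real.log (ε0 / Ω) := by
    have := mul_nonneg (hV₁.trans h) hL; linarith
  rw [div_le_div_iff₀ h1 h2]
  nlinarith

/-- `μ*` is monotone increasing in the phonon cutoff `Ω̃` (a larger phonon scale means less retardation):
`0 < Ω̃₁ ≤ Ω̃₂` ⇒ `μ*(Ω̃₁) ≤ μ*(Ω̃₂)` (`V_c ≥ 0`; the denominator at `Ω̃₂` positive). This is the sign of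
`dμ*/dΩ̃ = μ*²/Ω̃ > 0` (`coulombPseudopotential_hasDerivAt`). [cite: KresinMorawitzWolf2013, §2.2.2 Eq. (2.27) and §3.5.2 («the value of μ* depends on the phonon frequency»)] -/
theorem coulombPseudopotential_mono_omega {Vc ε0 Ω₁ Ω₂ : ℝ} (hV : 0 ≤ Vc) (hε : 0 < ε0) (hΩ₁ : 0 < Ω₁)
    (h : Ω₁ ≤ Ω₂) (hden : 0 < 1 + Vc * Real.log (ε0 / Ω₂)) :
    coulombPseudopotential Vc ε0 Ω₁ ≤ coulombPseudopotential Vc ε0 Ω₂ := by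
  unfold coulombPseudopotential
  have hlog : Real.log (ε0 / Ω₂) ≤ Real.log (ε0 / Ω₁) :=
    Real.log_le_log (div_pos hε (hΩ₁.trans_le h)) (div_le_div_of_nonneg_left hε.le hΩ₁ h)
  have hmul : Vc * Real.log (ε0 / Ω₂) ≤ Vc * Real.log (ε0 / Ω₁) := mul_le_mul_of_nonneg_left hlog hV
  exact div_le_div_of_nonneg_left hV hden (by linarith)

/-- `μ*` is antitone in the electronic scale `ε₀` (a wider electronic band means more retardation):
`0 < ε₁ ≤ ε₂` ⇒ `μ*(ε₂) ≤ μ*(ε₁)`. [cite: KresinMorawitzWolf2013, §2.2.2 Eq. (2.27)] -/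
theorem coulombPseudopotential_anti_eps {Vc ε₁ ε₂ Ω : ℝ} (hV : 0 ≤ Vc) (hΩ : 0 < Ω) (hε₁ : 0 < ε₁)
    (h : ε₁ ≤ ε₂) (hden : 0 < 1 + Vc * Real.log (ε₁ / Ω)) :
    coulombPseudopotential Vc ε₂ Ω ≤ coulombPseudopotential Vc ε₁ Ω := by
  unfold coulombPseudopotential
  have hlog : Real.log (ε₁ / Ω) ≤ Real.log (ε₂ / Ω) :=
    Real.log_le_log (div_pos hε₁ hΩ) (div_le_div_of_nonneg_right h hΩ.le)
  have hmul : Vc * Real.log (ε₁ / Ω) ≤ Vc * Real.log (ε₂ / Ω) := mul_le_mul_of_nonneg_left hlog hV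
  exact div_le_div_of_nonneg_left hV hden (by linarith)

/-- Splitting of the retardation logarithm between two cutoffs: `ln(ε₀/Ω̃₂) = ln(ε₀/Ω̃₁) + ln(Ω̃₁/Ω̃₂)`. [folklore] -/
private theorem log_cutoff_split {ε0 Ω₁ Ω₂ : ℝ} (hε : 0 < ε0) (hΩ₁ : 0 < Ω₁) (hΩ₂ : 0 < Ω₂) :
    Real.log (ε0 / Ω₂) = Real.log (ε0 / Ω₁) + Real.log (Ω₁ / Ω₂) := by
  rw [← Real.log_mul (div_pos hε hΩ₁).ne' (div_pos hΩ₁ hΩ₂).ne']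
  congr 1
  field_simp

/-- **Change of cutoff (composition law of the Morel–Anderson map).** Referring the same bare `V_c` to two
phonon cutoffs `Ω̃₁, Ω̃₂`, the pseudopotential at `Ω̃₂` is the Morel–Anderson map applied to `μ*(Ω̃₁)` with
`Ω̃₁` in the role of the electronic scale: `μ*(Ω̃₂) = μ*(Ω̃₁) / (1 + μ*(Ω̃₁) ln(Ω̃₁/Ω̃₂))`. This is the exact
content of «the value of `μ*_c` is linked to the cutoff frequency `ω_c` and it should be computed from
equation 59». [cite: FloreslivasEtAl2020, §3.2.3 Eq. (59); KresinMorawitzWolf2013, §2.2.2 Eq. (2.27)] -/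
theorem coulombPseudopotential_rescale {Vc ε0 Ω₁ Ω₂ : ℝ} (hε : 0 < ε0) (hΩ₁ : 0 < Ω₁) (hΩ₂ : 0 < Ω₂)
    (hden : 1 + Vc * Real.log (ε0 / Ω₁) ≠ 0) :
    coulombPseudopotential Vc ε0 Ω₂
      = coulombPseudopotential (coulombPseudopotential Vc ε0 Ω₁) Ω₁ Ω₂ := by
  unfold coulombPseudopotential
  rw [log_cutoff_split hε hΩ₁ hΩ₂]
  set L₁ := Real.log (ε0 / Ω₁)
  set L₁₂ := Real.log (Ω₁ / Ω₂)
  have hd : 1 + Vc / (1 + Vc * L₁) * L₁₂ = (1 + Vc * (L₁ + L₁₂)) / (1 + Vc * L₁) := by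
    field_simp
    ring
  rw [hd, div_div_eq_mul_div, div_mul_cancel₀ Vc hden]

/-- Reciprocal form of Eq. (2.27): `1/μ* = 1/V_c + ln(ε₀/Ω̃)` (`V_c ≠ 0`, `1 + V_c L ≠ 0`).
[cite: KresinMorawitzWolf2013, §2.2.2 Eq. (2.27)] -/
theorem inv_coulombPseudopotential {Vc ε0 Ω : ℝ} (hV : Vc ≠ 0)
    (hden : 1 + Vc * Real.log (ε0 / Ω) ≠ 0) :
    1 / coulombPseudopotential Vc ε0 Ω = 1 / Vc + Real.log (ε0 / Ω) := by
  unfold coulombPseudopotential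
  field_simp

/-- **Change of cutoff, reciprocal form**: `1/μ*(Ω̃₂) − 1/μ*(Ω̃₁) = ln(Ω̃₁/Ω̃₂)` — lowering the cutoff by a
factor `e` raises `1/μ*` by exactly one. [cite: FloreslivasEtAl2020, §3.2.3 Eq. (59); KresinMorawitzWolf2013, §2.2.2 Eq. (2.27)] -/
theorem inv_coulombPseudopotential_sub {Vc ε0 Ω₁ Ω₂ : ℝ} (hV : Vc ≠ 0) (hε : 0 < ε0) (hΩ₁ : 0 < Ω₁)
    (hΩ₂ : 0 < Ω₂) (hden₁ : 1 + Vc * Real.log (ε0 / Ω₁) ≠ 0)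
    (hden₂ : 1 + Vc * Real.log (ε0 / Ω₂) ≠ 0) :
    1 / coulombPseudopotential Vc ε0 Ω₂ - 1 / coulombPseudopotential Vc ε0 Ω₁ = Real.log (Ω₁ / Ω₂) := by
  rw [inv_coulombPseudopotential hV hden₂, inv_coulombPseudopotential hV hden₁,
    log_cutoff_split hε hΩ₁ hΩ₂]
  ring

/-- **Inversion**: the bare strength from the pseudopotential, `μ* / (1 − μ* ln(ε₀/Ω̃)) = V_c`
(`1 + V_c L ≠ 0`; note `1 − μ* L = 1/(1 + V_c L)`). [cite: KresinMorawitzWolf2013, §2.2.2 Eq. (2.27)] -/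
theorem coulombPseudopotential_div_eq_bare {Vc ε0 Ω : ℝ} (hden : 1 + Vc * Real.log (ε0 / Ω) ≠ 0) :
    coulombPseudopotential Vc ε0 Ω / (1 - coulombPseudopotential Vc ε0 Ω * Real.log (ε0 / Ω)) = Vc := by
  unfold coulombPseudopotential
  set L := Real.log (ε0 / Ω)
  have h1 : 1 - Vc / (1 + Vc * L) * L = 1 / (1 + Vc * L) := by
    field_simp
    ring
  rw [h1, div_div_eq_mul_div, div_one, div_mul_cancel₀ Vc hden]

/-- **Coulomb floor of the Allen–Dynes `T_c` at fixed `(ω_log, r, λ)`.** `T_c^{AD}` is antitone in `μ*`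
(`allenDynesTc_anti_mu`) and `μ* < 1/ln(ε₀/Ω̃)` for every `V_c ≥ 0` (`coulombPseudopotential_lt_inv_log`);
hence the value of `T_c^{AD}` at `μ* = 1/ln(ε₀/Ω̃)` bounds `T_c^{AD}` from below UNIFORMLY in the bare Coulomb
strength — provided that value is still in the physical domain (McMillan denominator positive there).
[cite: AllenDynes1975, Eq. (34); KresinMorawitzWolf2013, §2.2.2 Eq. (2.27)] -/
theorem allenDynesTc_coulomb_floor {omegaLog r lam Vc ε0 Ω : ℝ} (hω : 0 ≤ omegaLog) (hr : 1 ≤ r)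
    (hlam : 0 ≤ lam) (hV : 0 ≤ Vc) (hL : 0 < Real.log (ε0 / Ω))
    (hD : 0 < mcMillanDenom lam (1 / Real.log (ε0 / Ω))) :
    allenDynesTc omegaLog r lam (1 / Real.log (ε0 / Ω))
      ≤ allenDynesTc omegaLog r lam (coulombPseudopotential Vc ε0 Ω) :=
  allenDynesTc_anti_mu hω hr hlam (coulombPseudopotential_nonneg hV hL.le)
    (coulombPseudopotential_lt_inv_log hV hL).le hD

/-- The same Coulomb floor for the McMillan form. [cite: AllenDynes1975, Eq. (34); KresinMorawitzWolf2013, §2.2.2 Eq. (2.27)] -/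
theorem mcMillanTc_coulomb_floor {omega lam Vc ε0 Ω : ℝ} (hω : 0 ≤ omega) (hlam : 0 ≤ lam)
    (hV : 0 ≤ Vc) (hL : 0 < Real.log (ε0 / Ω)) (hD : 0 < mcMillanDenom lam (1 / Real.log (ε0 / Ω))) :
    mcMillanTc omega lam (1 / Real.log (ε0 / Ω)) ≤ mcMillanTc omega lam (coulombPseudopotential Vc ε0 Ω) :=
  mcMillanTc_anti_mu hω hlam (coulombPseudopotential_lt_inv_log hV hL).le hD

/-! ## Large-coupling behaviour: the McMillan form saturates in `λ`, the Allen–Dynes form does not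
(appended 2026-08-27, hubbard-downfold lit-4) -/

/-- The McMillan exponent never falls below its `λ → ∞` limit:
`1.04 (1 + λ)/(λ − μ*(1 + 0.62λ)) ≥ 1.04/(1 − 0.62 μ*)` on the physical domain (`μ* ≥ 0`, `0.62 μ* < 1`,
denominator positive); the difference of the cross-multiplied sides is `1.04 (1 + 0.38 μ*) ≥ 0`.
[cite: Mcmillan1968, Eq. (18); FloreslivasEtAl2020, §3.2.4 Eq. (65)] -/
theorem mcMillanExponent_ge_limit {lam mu : ℝ} (hmu : 0 ≤ mu) (hmu' : 0.62 * mu < 1)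
    (hD : 0 < mcMillanDenom lam mu) :
    1.04 / (1 - 0.62 * mu) ≤ mcMillanExponent lam mu := by
  unfold mcMillanExponent
  rw [mcMillanDenom_eq] at hD ⊢
  have h1 : 0 < 1 - 0.62 * mu := by linarith
  rw [div_le_div_iff₀ h1 hD]
  nlinarith

/-- **Saturation of the McMillan form.** At fixed `ω ≥ 0` and `μ*`, for EVERY `λ` in the physical domain
`T_c^{McM}(ω, λ, μ*) ≤ (ω/1.2) · exp(−1.04/(1 − 0.62 μ*))` — the formula is bounded in `λ` («above
[`λ ≈ 1.5`] it tends to saturate, underestimating the true critical temperature»; e.g. `μ* = 0.1`: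
`T_c^{McM} < 0.275 ω`). [cite: FloreslivasEtAl2020, §3.2.4 (discussion of Fig. 15); Mcmillan1968, Eq. (18)] -/
theorem mcMillanTc_le_saturation {omega lam mu : ℝ} (hω : 0 ≤ omega) (hmu : 0 ≤ mu)
    (hmu' : 0.62 * mu < 1) (hD : 0 < mcMillanDenom lam mu) :
    mcMillanTc omega lam mu ≤ omega / 1.2 * Real.exp (-(1.04 / (1 - 0.62 * mu))) := by
  unfold mcMillanTc
  have h := mcMillanExponent_ge_limit hmu hmu' hD
  exact mul_le_mul_of_nonneg_left (Real.exp_le_exp.mpr (by linarith)) (by positivity)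

/-- `f₁ ≥ √(λ/Λ₁)`: the strong-coupling factor grows at least like `λ^{1/2}`
(`(1 + y^{3/2})^{1/3} ≥ (y^{3/2})^{1/3} = y^{1/2}`). [cite: AllenDynes1975, Eq. (35)] -/
theorem sqrt_le_allenDynesF1 {lam mu : ℝ} (hlam : 0 ≤ lam) (hmu : 0 ≤ mu) :
    Real.sqrt (lam / allenDynesLambda1 mu) ≤ allenDynesF1 lam mu := by
  unfold allenDynesF1
  set y := lam / allenDynesLambda1 mu with hy
  have hy0 : 0 ≤ y := div_nonneg hlam (allenDynesLambda1_pos hmu).le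
  have hy32 : 0 ≤ y ^ ((3 : ℝ) / 2) := Real.rpow_nonneg hy0 _
  have hsqrt : Real.sqrt y = (y ^ ((3 : ℝ) / 2)) ^ ((1 : ℝ) / 3) := by
    rw [← Real.rpow_mul hy0, Real.sqrt_eq_rpow]
    norm_num
  rw [hsqrt]
  exact Real.rpow_le_rpow hy32 (by linarith) (by norm_num)

/-- **`T_c^{AD} ≥ √(λ/Λ₁) · T_c^{McM}`** (`f₁ ≥ √(λ/Λ₁)`, `f₂ ≥ 1`): unlike the McMillan form, the
Allen–Dynes `T_c` carries the `λ^{1/2}` growth of the very-strong-coupling Eliashberg `T_c`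
(«`T_c ∝ λ^{1/2} Ω̃`»). [cite: AllenDynes1975, Eqs. (34)–(35); KresinMorawitzWolf2013, §2.2.2 p. 110] -/
theorem sqrt_mul_mcMillanTc_le_allenDynesTc {omegaLog r lam mu : ℝ} (hω : 0 ≤ omegaLog) (hr : 1 ≤ r)
    (hlam : 0 ≤ lam) (hmu : 0 ≤ mu) :
    Real.sqrt (lam / allenDynesLambda1 mu) * mcMillanTc omegaLog lam mu
      ≤ allenDynesTc omegaLog r lam mu := by
  unfold allenDynesTc
  have hF1 := sqrt_le_allenDynesF1 hlam hmu
  have hF2 := one_le_allenDynesF2 lam mu hr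
  have hT := mcMillanTc_nonneg lam mu hω
  have hF1pos := (allenDynesF1_pos hlam hmu).le
  calc Real.sqrt (lam / allenDynesLambda1 mu) * mcMillanTc omegaLog lam mu
      ≤ allenDynesF1 lam mu * mcMillanTc omegaLog lam mu := mul_le_mul_of_nonneg_right hF1 hT
    _ = allenDynesF1 lam mu * 1 * mcMillanTc omegaLog lam mu := by ring
    _ ≤ allenDynesF1 lam mu * allenDynesF2 lam mu r * mcMillanTc omegaLog lam mu :=
        mul_le_mul_of_nonneg_right (mul_le_mul_of_nonneg_left hF2 hF1pos) hT

/-- **No saturation for the Allen–Dynes form**: at fixed `ω_log > 0`, `r ≥ 1` and `μ* ≥ 0` with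
`0.62 μ* < 1`, `T_c^{AD}(ω_log, r, λ, μ*)` exceeds every prescribed `T₀` for `λ` large enough (inside the
physical domain). Nothing is asserted about the accuracy of the formula at such `λ`.
[cite: AllenDynes1975, Eqs. (34)–(35); KresinMorawitzWolf2013, §2.2.2 p. 110; FloreslivasEtAl2020, §3.2.4] -/
theorem allenDynesTc_unbounded {omegaLog r mu : ℝ} (hω : 0 < omegaLog) (hr : 1 ≤ r) (hmu : 0 ≤ mu)
    (hmu' : 0.62 * mu < 1) (T₀ : ℝ) :
    ∃ lam : ℝ, 0 ≤ lam ∧ T₀ < allenDynesTc omegaLog r lam mu := by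
  have h1 : 0 < 1 - 0.62 * mu := by linarith
  -- a coupling λ₀ inside the physical domain
  set lam0 : ℝ := mu / (1 - 0.62 * mu) + 1 with hlam0
  have hlam0_nn : 0 ≤ lam0 := by positivity
  have hD0 : 0 < mcMillanDenom lam0 mu := by
    rw [mcMillanDenom_eq]
    have : (1 - 0.62 * mu) * lam0 - mu = 1 - 0.62 * mu := by
      rw [hlam0]; field_simp; ring
    linarith
  set c := mcMillanTc omegaLog lam0 mu with hc
  have hc_pos : 0 < c := mcMillanTc_pos lam0 mu hω
  set L := allenDynesLambda1 mu with hL_def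
  have hL : 0 < L := allenDynesLambda1_pos hmu
  -- λ ≥ λ₀ with λ/Λ₁ ≥ (T₀/c)² + 1
  set lam := max lam0 (L * ((T₀ / c) ^ 2 + 1)) with hlam
  have hlam_ge : lam0 ≤ lam := le_max_left _ _
  have hlam_nn : 0 ≤ lam := hlam0_nn.trans hlam_ge
  refine ⟨lam, hlam_nn, ?_⟩
  have hmu'' : 0.62 * mu ≤ 1 := hmu'.le
  have hTge : c ≤ mcMillanTc omegaLog lam mu := mcMillanTc_mono_lam hω.le hmu hmu'' hD0 hlam_ge
  have hratio : (T₀ / c) ^ 2 + 1 ≤ lam / L := by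
    rw [le_div_iff₀ hL]
    have := le_max_right lam0 (L * ((T₀ / c) ^ 2 + 1))
    linarith
  have hsq : T₀ / c < Real.sqrt (lam / L) := by
    calc T₀ / c ≤ |T₀ / c| := le_abs_self _
      _ = Real.sqrt ((T₀ / c) ^ 2) := (Real.sqrt_sq_eq_abs _).symm
      _ < Real.sqrt (lam / L) := Real.sqrt_lt_sqrt (sq_nonneg _) (by linarith)
  have h2 : T₀ < Real.sqrt (lam / L) * c := by
    have := (div_lt_iff₀ hc_pos).mp hsq
    linarith
  have h3 : Real.sqrt (lam / L) * c ≤ Real.sqrt (lam / L) * mcMillanTc omegaLog lam mu :=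
    mul_le_mul_of_nonneg_left hTge (Real.sqrt_nonneg _)
  have key := sqrt_mul_mcMillanTc_le_allenDynesTc hω.le hr hlam_nn hmu (r := r)
  exact lt_of_lt_of_le h2 (h3.trans key)

/-! ## The inverted McMillan formula: `λ` from a measured `T_c` and a phonon scale -/

/-- The denominator of the inverted McMillan formula, `D(L, μ*) = (1 − 0.62 μ*) L − 1.04`; the inversion is
meaningful where it is positive (`L` above `1.04/(1 − 0.62μ*)`). [cite: KlimczukEtAl2012Heusler, p. 10 (inverted McMillan formula; derived)] -/
def mcMillanInvDenom (L mu : ℝ) : ℝ := (1 - 0.62 * mu) * L - 1.04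

/-- **Inverted McMillan formula.** With `L = ln(θ/T_c)` the logarithm of the prefactor temperature over `T_c`
(`θ = Θ_D/1.45` in McMillan's normalisation, `θ = ω/1.2` in the one of `mcMillanTc`):
`λ_inv(L, μ*) = (1.04 + μ* L) / ((1 − 0.62 μ*) L − 1.04)`.
[cite: KlimczukEtAl2012Heusler, p. 10 («λ_ep can be calculated from the inverted McMillan's formula»)]; [cite: Mcmillan1968, Eq. (18) (the form being inverted)] -/
def mcMillanLambdaInv (L mu : ℝ) : ℝ := (1.04 + mu * L) / mcMillanInvDenom L mu

/-- On the inverted value the McMillan denominator equals `1.04 (1 + 0.38 μ*)/D`.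
[cite: KlimczukEtAl2012Heusler, p. 10 (derived)]; [cite: Mcmillan1968, Eq. (18)] -/
theorem mcMillanDenom_lambdaInv (L mu : ℝ) (hD : mcMillanInvDenom L mu ≠ 0) :
    mcMillanDenom (mcMillanLambdaInv L mu) mu = 1.04 * (1 + 0.38 * mu) / mcMillanInvDenom L mu := by
  unfold mcMillanDenom mcMillanLambdaInv
  rw [eq_div_iff hD]
  have hx : (1.04 + mu * L) / mcMillanInvDenom L mu * mcMillanInvDenom L mu = 1.04 + mu * L :=
    div_mul_cancel₀ _ hD
  have hDdef : mcMillanInvDenom L mu = (1 - 0.62 * mu) * L - 1.04 := rfl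
  linear_combination (1 - 0.62 * mu) * hx - mu * hDdef

/-- `1 + λ_inv = (1 + 0.38 μ*) L / D`. [cite: KlimczukEtAl2012Heusler, p. 10 (derived)] -/
theorem one_add_lambdaInv (L mu : ℝ) (hD : mcMillanInvDenom L mu ≠ 0) :
    1 + mcMillanLambdaInv L mu = (1 + 0.38 * mu) * L / mcMillanInvDenom L mu := by
  unfold mcMillanLambdaInv
  rw [eq_div_iff hD]
  have hx : (1.04 + mu * L) / mcMillanInvDenom L mu * mcMillanInvDenom L mu = 1.04 + mu * L :=
    div_mul_cancel₀ _ hD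
  have hDdef : mcMillanInvDenom L mu = (1 - 0.62 * mu) * L - 1.04 := rfl
  linear_combination hx + hDdef

/-- **Exactness of the inversion (exponent form):** the McMillan exponent evaluated at `λ_inv(L, μ*)` is `L`
itself, whenever `D ≠ 0` and `1 + 0.38 μ* ≠ 0`. [cite: KlimczukEtAl2012Heusler, p. 10 (derived)]; [cite: Mcmillan1968, Eq. (18)] -/
theorem mcMillanExponent_lambdaInv (L mu : ℝ) (hD : mcMillanInvDenom L mu ≠ 0) (hmu : 1 + 0.38 * mu ≠ 0) :
    mcMillanExponent (mcMillanLambdaInv L mu) mu = L := by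
  unfold mcMillanExponent
  rw [mcMillanDenom_lambdaInv L mu hD, one_add_lambdaInv L mu hD]
  have hne : 1.04 * (1 + 0.38 * mu) / mcMillanInvDenom L mu ≠ 0 :=
    div_ne_zero (mul_ne_zero (by norm_num) hmu) hD
  rw [div_eq_iff hne]
  ring

/-- **Exactness of the inversion (`T_c` form):** feeding `λ_inv(ln(ω/(1.2 T_c)), μ*)` back into `mcMillanTc`
returns the measured `T_c` (for `ω, T_c > 0` on the domain `D ≠ 0`, `1 + 0.38μ* ≠ 0`).
[cite: KlimczukEtAl2012Heusler, p. 10, Table II (λ_ep from T_c and Θ_D)]; [cite: AllenDynes1975, Eq. (34)] -/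
theorem mcMillanTc_lambdaInv {omega Tc : ℝ} (mu : ℝ) (hω : 0 < omega) (hT : 0 < Tc)
    (hD : mcMillanInvDenom (Real.log (omega / (1.2 * Tc))) mu ≠ 0) (hmu : 1 + 0.38 * mu ≠ 0) :
    mcMillanTc omega (mcMillanLambdaInv (Real.log (omega / (1.2 * Tc))) mu) mu = Tc := by
  unfold mcMillanTc
  rw [mcMillanExponent_lambdaInv _ mu hD hmu, Real.exp_neg, Real.exp_log (by positivity), inv_div]
  have hω' : omega ≠ 0 := hω.ne'
  field_simp

/-- **Monotonicity in the phonon scale:** at fixed `μ* ≥ 0` with `0.62 μ* < 1`, on the domain `D > 0` the inverted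
coupling is STRICTLY DECREASING in `L` — a larger prefactor temperature for the same `T_c` needs a smaller `λ`
(and a soft `ω_log ≪ Θ_D` a larger one). [cite: KlimczukEtAl2012Heusler, p. 12–13 («there is another variable (Debye temperature) in the formula»; derived)] -/
theorem mcMillanLambdaInv_anti_L {mu L₁ L₂ : ℝ} (hmu : 0 ≤ mu) (hmu' : 0.62 * mu < 1)
    (hD₁ : 0 < mcMillanInvDenom L₁ mu) (h : L₁ < L₂) :
    mcMillanLambdaInv L₂ mu < mcMillanLambdaInv L₁ mu := by
  unfold mcMillanLambdaInv
  unfold mcMillanInvDenom at *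
  have hb : 0 < 1 - 0.62 * mu := by linarith
  have hD₂ : 0 < (1 - 0.62 * mu) * L₂ - 1.04 := by nlinarith [mul_pos hb (sub_pos.mpr h)]
  rw [div_lt_div_iff₀ hD₂ hD₁]
  nlinarith [mul_pos hb (sub_pos.mpr h), mul_nonneg hmu (sub_pos.mpr h).le]

/-- **Monotonicity in `μ*`:** at fixed `L > 0`, on the domain where the denominator stays positive, the inverted
coupling is increasing in `μ*` (Klimczuk: `μ* 0.13 → 0.15` moves YPd₂Sn's λ_ep `0.70 → 0.75`).
[cite: KlimczukEtAl2012Heusler, p. 10 («Using a value of μ* of 0.15 causes increase of λ_ep to 0.75»)] -/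
theorem mcMillanLambdaInv_mono_mu {L m₁ m₂ : ℝ} (hL : 0 < L) (hm₁ : 0 ≤ m₁) (h : m₁ ≤ m₂)
    (hD₂ : 0 < mcMillanInvDenom L m₂) :
    mcMillanLambdaInv L m₁ ≤ mcMillanLambdaInv L m₂ := by
  unfold mcMillanLambdaInv
  unfold mcMillanInvDenom at *
  have hD₁ : 0 < (1 - 0.62 * m₁) * L - 1.04 := by nlinarith [mul_nonneg hL.le (sub_nonneg.mpr h)]
  rw [div_le_div_iff₀ hD₁ hD₂]
  nlinarith [mul_nonneg hL.le (sub_nonneg.mpr h), mul_nonneg (mul_nonneg hL.le hL.le) (sub_nonneg.mpr h),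
    mul_nonneg hm₁ hL.le, mul_nonneg (mul_nonneg hm₁ hL.le) (sub_nonneg.mpr h)]

/-- YPd₂Sn (Klimczuk Table II: `Θ_D = 210 K`, `T_c = 4.7 K`, so `L = ln(210/(1.45·4.7)) = ln 30.8 ∈ [3.42, 3.44]`,
taken as the hypothesis): at `μ* = 0.13` the inverted coupling lies in `(0.70, 0.71)` (printed 0.70) and at
`μ* = 0.15` in `(0.74, 0.76)` (printed 0.75), for EVERY `L` in the window (monotone in `L`, so the two
endpoints suffice). [cite: KlimczukEtAl2012Heusler, Table II (YPd₂Sn λ_ep 0.70) and p. 10 («0.75»)] -/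
theorem mcMillanLambdaInv_klimczuk_window {L : ℝ} (hlo : 3.42 ≤ L) (hhi : L ≤ 3.44) :
    0.70 < mcMillanLambdaInv L 0.13 ∧ mcMillanLambdaInv L 0.13 < 0.71 ∧
      0.74 < mcMillanLambdaInv L 0.15 ∧ mcMillanLambdaInv L 0.15 < 0.76 := by
  have hD13 : ∀ {x : ℝ}, 3.42 ≤ x → 0 < mcMillanInvDenom x 0.13 := by
    intro x hx; unfold mcMillanInvDenom; nlinarith
  have hD15 : ∀ {x : ℝ}, 3.42 ≤ x → 0 < mcMillanInvDenom x 0.15 := by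
    intro x hx; unfold mcMillanInvDenom; nlinarith
  -- values at the window ends
  have e13hi : 0.70 < mcMillanLambdaInv 3.44 0.13 := by unfold mcMillanLambdaInv mcMillanInvDenom; norm_num
  have e13lo : mcMillanLambdaInv 3.42 0.13 < 0.71 := by unfold mcMillanLambdaInv mcMillanInvDenom; norm_num
  have e15hi : 0.74 < mcMillanLambdaInv 3.44 0.15 := by unfold mcMillanLambdaInv mcMillanInvDenom; norm_num
  have e15lo : mcMillanLambdaInv 3.42 0.15 < 0.76 := by unfold mcMillanLambdaInv mcMillanInvDenom; norm_num
  -- monotone transport to `L`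
  have m13a : mcMillanLambdaInv 3.44 0.13 ≤ mcMillanLambdaInv L 0.13 := by
    rcases eq_or_lt_of_le hhi with h | h
    · rw [h]
    · exact (mcMillanLambdaInv_anti_L (by norm_num) (by norm_num) (hD13 hlo) h).le
  have m13b : mcMillanLambdaInv L 0.13 ≤ mcMillanLambdaInv 3.42 0.13 := by
    rcases eq_or_lt_of_le hlo with h | h
    · rw [h]
    · exact (mcMillanLambdaInv_anti_L (by norm_num) (by norm_num) (hD13 le_rfl) h).le
  have m15a : mcMillanLambdaInv 3.44 0.15 ≤ mcMillanLambdaInv L 0.15 := by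
    rcases eq_or_lt_of_le hhi with h | h
    · rw [h]
    · exact (mcMillanLambdaInv_anti_L (by norm_num) (by norm_num) (hD15 hlo) h).le
  have m15b : mcMillanLambdaInv L 0.15 ≤ mcMillanLambdaInv 3.42 0.15 := by
    rcases eq_or_lt_of_le hlo with h | h
    · rw [h]
    · exact (mcMillanLambdaInv_anti_L (by norm_num) (by norm_num) (hD15 le_rfl) h).le
  exact ⟨lt_of_lt_of_le e13hi m13a, lt_of_le_of_lt m13b e13lo, lt_of_lt_of_le e15hi m15a,
    lt_of_le_of_lt m15b e15lo⟩

end Literature.MathematicalPhysics.QuantumManyBody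

end
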